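import Literature.NumberTheory.Sieve.BombieriFriedlanderIwaniecLemma1Corrected
import Literature.NumberTheory.Sieve.BombieriFriedlanderIwaniecDispersionLemma7
import Literature.NumberTheory.Sieve.BombieriFriedlanderIwaniecTheorem5Poisson
import Literature.NumberTheory.Sieve.RamanujanSum
import Literature.NumberTheory.Sieve.DivisorBound
import Literature.NumberTheory.LFunctions.KloostermanPrimePower
import HarnessLib

/-!
# BFI 1986 / 2019, the corrected Lemma 1 (Deshouillers–Iwaniec's Theorem 12): the completion step

Topic `Literature/NumberTheory/Sieve`.  Everything here is PROVED; no named fact is introduced.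

E. Bombieri, J. B. Friedlander, H. Iwaniec, *Primes in arithmetic progressions to large moduli*,
Acta Math. 156 (1986), 203–251, §2 Lemma 1 (p. 210) = J.-M. Deshouillers, H. Iwaniec,
*Kloosterman sums and Fourier coefficients of cusp forms*, Invent. Math. 70 (1982), Theorem 12,
CORRECTED in E. Bombieri, J. B. Friedlander, H. Iwaniec, *Some corrections to an old paper*,
arXiv:1903.01371 (2019), §2 Lemma 2.1: for `g(c, d) = g₀(c/C, d/D)`,
`𝓚(C,D,N,R,S) = ∑_{r∼R} ∑_{s∼S} ∑_{0<n≤N} B_{nrs} ∑∑_{(rd,sc)=1} g(c,d) e(n (rd)‾/(sc)) ≪ (CDNRS)^ε 𝓘 ‖B‖`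
with `𝓘² = CS(RS+N)(C+DR) + C²DS√((RS+N)R) + D²NR` ("This modification of the final term is the
follow-up of the correction of the bound (9.11) of [DI], wherein the quantity `D(NR/S)^{1/2}` needs
to be replaced by `D(NR)^{1/2}`").  In the tree the corrected statement for the plateau weight
`w ⊗ w` is the hypothesis predicate `BFI.Lemma1BoundCorrected BFI.plateau2 (5/4)`
(`…Lemma1Corrected`), from which Theorems 1, 5, 5* follow (`…_of_lemma1corr`); the misprinted
predicate `BFI.Lemma1BoundFor BFI.plateau2 (5/4)` is refuted in `…Lemma1Refutation`.

This file carries out, for the weight `w ⊗ w`, **the first step of Deshouillers–Iwaniec's proof of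
Theorem 12** (Invent. Math. 70, §9.2; described in BFI 2019 §2 and in A. Pascadi, Forum Math. Pi 14
(2026) e8, proof of Cor. 18: "completing Kloosterman sums, passing from the `d`-variable to a
variable of size `≪ (CDS)^ε CS/D`"): Poisson summation in `d` in each reduced residue class modulo
`k = sc`, which turns the incomplete sums into complete Kloosterman sums, and the estimation of the
zero frequency — exactly the term whose bound `D(NR)^{1/2}` (not `D(NR/S)^{1/2}`) is the 2019
correction.

1. (§1–2) For `(r, k) = 1`:
   `∑_{d ≤ 5D/4, (rd,k)=1} w(d/D) e(n(rd)‾/k) = ∑_{(δ,k)=1} Ψ(δ) A(k, δ)`, `Ψ(δ) = e(n (rδ)‾/k)`,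
   `A(k, δ) = ∑_{d ≡ δ (k)} w(d/D)` (`BFI.classSum (D/2) (D/4) k δ` of `…Theorem5Poisson`, as
   `w(d/D) = BFI.bump (D/2) (D/4) d`); the Poisson expansion `A(k,δ) = k⁻¹(α̂₀ + ∑_{1≤|h|≤H₀} e(δh/k) Φ_k(h)) + O(k⁻¹ tailBound)`
   (`BFI.norm_classSum_sub_le`) then gives **`BFI.L1.norm_inner_sub_model_le`**:
   `inner sum = [(r,k)=1] k⁻¹ (α̂₀ c_k(n) + ∑_{1≤h≤H₀} (Φ_k(h) 𝓢_k(h;n,r) + Φ_k(−h) 𝓢_k(−h;n,r))) + O(tailBound(D/4, j, k, H₀))`,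
   with Ramanujan's sum `c_k(n) = ∑_{(δ,k)=1} Ψ(δ)` (`BFI.L1.sum_psi_eq_ramanujanSum`: `δ ↦ (rδ)‾`
   permutes `(ℤ/k)ˣ`) and the Kloosterman sums `𝓢_k(h; n, r) = ∑_{(x,k)=1} e((n (rx)‾ + hx)/k) = S(h, n r̄; k)`
   (`BFI.L1.kl`; `BFI.L1.kl_eq_kloostermanSum` identifies it with the tree's
   `Literature.NumberTheory.LFunctions.kloostermanSum k h (n r̄)`).
2. (§3) **`𝓚 = 𝓚₀ + 𝓚♯(H₀) + O(∑ |B| ∑_c tailBound)`** (`BFI.L1.Kzero`, `BFI.L1.Koff`,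
   `BFI.L1.norm_dispK_sub_Kzero_sub_Koff_le`).
3. (§4) **The zero frequency, corrected (9.11):** `‖𝓚₀‖ ≤ K₀(η) (CDNRS)^η D(NR)^{1/2} ‖B‖`
   (`BFI.L1.norm_Kzero_le`), from `|c_q(n)| ≤ τ(n)(q, n)`, `(sc, n) ≤ (s, n)(c, n)`,
   `∑_{m≤M}(n,m)/m ≤ τ(n)(1 + log M)` (`BFI.L7.sum_gcd_div_le`), Cauchy's inequality and the
   divisor bound — the `s`-average produces no factor `S⁻¹`, in accordance with the correction.
4. (§5) The tails are `O_ε(‖B‖)` for `H₀ = ⌈2(CDNRS)^ε SC/D⌉` (`BFI.L1.tail_total_le`).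
5. (§6) **The reduction** `BFI.L1.norm_dispK_le_of_offdiag` /
   `BFI.lemma1BoundCorrected_plateau2_of_offdiag`: if the off-diagonal part satisfies
   `‖𝓚♯(H₀)‖ ≤ K(ε) (CDNRS)^ε {CS(RS+N)(C+DR) + C²DS√((RS+N)R)}^{1/2} ‖B‖` — the bound Deshouillers
   and Iwaniec derive from Kuznetsov's formula for `Γ₀(rs)` at the cusps `∞`, `1/s` and their large
   sieve inequalities (the genuinely spectral part, in neither Mathlib nor the tree) — then
   `BFI.Lemma1BoundCorrected BFI.plateau2 (5/4)` holds, hence BFI's Theorems 1, 5, 5*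
   (`BombieriFriedlanderIwaniecTheorem1_of_offdiag`, `…Theorem5_of_offdiag`,
   `…Theorem5Star_of_offdiag`, `…Theorem5StarInterval_of_offdiag`).

What remains unproved for the whole BFI cone after this file is thus the off-diagonal bound for the
explicit finite sums `BFI.L1.Koff` of complete Kloosterman sums.

## References

* E. Bombieri, J. B. Friedlander, H. Iwaniec, *Some corrections to an old paper*, arXiv:1903.01371
  (2019), §2, Lemma 2.1 and the remark on (9.11) of [DI]. [BombieriFriedlanderIwaniec2019]
* E. Bombieri, J. B. Friedlander, H. Iwaniec, Acta Math. 156 (1986), 203–251, §2 Lemma 1 p. 210,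
  Lemma 2 p. 209 (Poisson). [BombieriFriedlanderIwaniecActa1986]
* J.-M. Deshouillers, H. Iwaniec, Invent. Math. 70 (1982), 219–288, Theorem 12, §9.2, (9.11).
* A. Pascadi, *Large sieve inequalities for exceptional Maass forms and the greatest prime factor of
  `n² + 1`*, Forum Math. Pi 14 (2026) e8 (arXiv:2404.04239), Corollary 18 and its proof.
-/

noncomputable section

open Finset Real
open scoped ArithmeticFunction.sigma ContDiff FourierTransform ComplexConjugate

namespace Literature.NumberTheory.Sieve

namespace BFI

namespace L1

/-! ### The weight `w(d/D)` is the weight `α` of `…Theorem5Weights` with `M = D/2`, `Y = D/4` -/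

/-- `w(t/D) = bump (D/2) (D/4) t` for `D > 0` (`w = bump (1/2) (1/4)`). [folklore] -/
theorem plateau1_div {D : ℝ} (hD : 0 < D) (t : ℝ) : plateau1 (t / D) = bump (D / 2) (D / 4) t := by
  unfold plateau1 bump
  have hD0 : D ≠ 0 := hD.ne'
  congr 2
  · congr 1; field_simp
  · congr 1; field_simp

/-- `⌊2 (D/2) + D/4⌋ = ⌊5/4 · D⌋`: the range `mRange (D/2) (D/4)` of `…Theorem5Poisson` is
`{0, …, ⌊5D/4⌋}`. [folklore] -/
theorem mRange_half_quarter (D : ℝ) : mRange (D / 2) (D / 4) = Finset.range (⌊5 / 4 * D⌋₊ + 1) := by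
  unfold mRange
  congr 3
  ring

/-! ### Complete sums over the reduced residues modulo `k` -/

/-- The complete exponential sum `𝓢_k(h; n, r) = ∑_{x mod k, (x,k)=1} e(n (rx)‾/k) e(xh/k)` — for
`(r, k) = 1` this is the Kloosterman sum `S(h, n r̄; k)` (substitute `x ↦ x̄`). [folklore] -/
def kl (k r : ℕ) (n h : ℤ) : ℂ :=
  ∑ x ∈ (Finset.range k).filter (fun x => x.Coprime k),
    (𝐞 ((n : ℝ) * (((((r * x : ℕ) : ZMod k))⁻¹).val : ℝ) / k) : ℂ) * (𝐞 ((x : ℝ) * h / k) : ℂ)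

/-- The phase `Ψ(δ) = e(n · ((r δ)⁻¹ mod k)/k)` as a function of the residue `δ`. [folklore] -/
def psi (k r : ℕ) (n : ℤ) (δ : ZMod k) : ℂ :=
  (𝐞 ((n : ℝ) * ((((r : ZMod k) * δ)⁻¹).val : ℝ) / k) : ℂ)

/-- `|Ψ(δ)| = 1`. [folklore] -/
theorem norm_psi (k r : ℕ) (n : ℤ) (δ : ZMod k) : ‖psi k r n δ‖ = 1 := by
  unfold psi; exact Circle.norm_coe _

/-- `e(y.val / k)` is Mathlib's standard additive character of `ℤ/k` at `y`. [folklore] -/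
theorem e_val_div_eq_stdAddChar {k : ℕ} [NeZero k] (y : ZMod k) :
    (𝐞 ((y.val : ℝ) / k) : ℂ) = ZMod.stdAddChar y := by
  rw [ZMod.stdAddChar_apply, ZMod.toCircle_eq_circleExp, Real.fourierChar_apply']

/-- `e(m/k)` only depends on the integer `m` modulo `k`: `e(m/k) = e((m mod k).val/k)`, i.e.
`e(m/k) = stdAddChar (m : ℤ/k)`. [folklore] -/
theorem e_intCast_div_eq_stdAddChar {k : ℕ} [NeZero k] (m : ℤ) :
    (𝐞 ((m : ℝ) / k) : ℂ) = ZMod.stdAddChar (m : ZMod k) := by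
  rw [ZMod.stdAddChar_coe, Real.fourierChar_apply]
  congr 1
  push_cast
  ring

/-- **`BFI.L1.kl` is the Kloosterman sum of the tree**: for `(r, k) = 1`,
`𝓢_k(h; n, r) = ∑_{(x,k)=1} e((n (rx)‾ + hx)/k) = S(h, n r̄; k)` in the normalisation
`S(a, b; q) = ∑_{x ∈ (ℤ/q)ˣ} e((ax + bx⁻¹)/q)` of `Literature.NumberTheory.LFunctions.kloostermanSum`.
[folklore] -/
theorem kl_eq_kloostermanSum {k : ℕ} [NeZero k] {r : ℕ} (hr : r.Coprime k) (n h : ℤ) :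
    kl k r n h = LFunctions.kloostermanSum k (h : ZMod k) ((n : ZMod k) * ((r : ZMod k))⁻¹) := by
  classical
  unfold kl LFunctions.kloostermanSum
  -- the right side as a sum over `0 ≤ x < k`, `(x, k) = 1`
  rw [LFunctions.sum_zmod_eq_sum_range, ← Finset.sum_filter_add_sum_filter_not (Finset.range k)
    (fun x : ℕ => x.Coprime k)]
  have hzero : ∑ x ∈ (Finset.range k).filter (fun x : ℕ => ¬ x.Coprime k),
      (if IsUnit ((x : ℕ) : ZMod k) then
        (ZMod.stdAddChar ((h : ZMod k) * ((x : ℕ) : ZMod k) +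
          (n : ZMod k) * ((r : ZMod k))⁻¹ * (((x : ℕ) : ZMod k))⁻¹) : ℂ)
       else 0) = 0 := by
    refine Finset.sum_eq_zero fun x hx => ?_
    rw [Finset.mem_filter] at hx
    rw [if_neg]
    rw [ZMod.isUnit_iff_coprime]
    exact hx.2
  rw [hzero, add_zero]
  refine Finset.sum_congr rfl fun x hx => ?_
  rw [Finset.mem_filter] at hx
  have hxu : IsUnit ((x : ℕ) : ZMod k) := (ZMod.isUnit_iff_coprime x k).2 hx.2
  rw [if_pos hxu]
  -- units
  set ru : (ZMod k)ˣ := ZMod.unitOfCoprime r hr with hru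
  set xu : (ZMod k)ˣ := ZMod.unitOfCoprime x hx.2 with hxu'
  have hr' : ((r : ℕ) : ZMod k) = (ru : ZMod k) := by rw [hru, ZMod.coe_unitOfCoprime]
  have hx' : ((x : ℕ) : ZMod k) = (xu : ZMod k) := by rw [hxu', ZMod.coe_unitOfCoprime]
  have hinv : ((r : ZMod k) * ((x : ℕ) : ZMod k))⁻¹ = ((r : ZMod k))⁻¹ * (((x : ℕ) : ZMod k))⁻¹ := by
    rw [hr', hx', ← Units.val_mul, ZMod.inv_coe_unit, ZMod.inv_coe_unit, ZMod.inv_coe_unit,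
      mul_inv_rev, Units.val_mul, mul_comm]
  -- first factor
  have h1 : (𝐞 ((n : ℝ) * (((((r * x : ℕ) : ZMod k))⁻¹).val : ℝ) / k) : ℂ) =
      ZMod.stdAddChar ((n : ZMod k) * ((r : ZMod k))⁻¹ * ((x : ZMod k))⁻¹) := by
    rw [show (n : ℝ) * (((((r * x : ℕ) : ZMod k))⁻¹).val : ℝ) =
      (((n * ((((r * x : ℕ) : ZMod k))⁻¹).val : ℤ)) : ℝ) by push_cast; ring]
    rw [e_intCast_div_eq_stdAddChar]
    congr 1
    push_cast
    rw [hinv, mul_assoc, ZMod.natCast_zmod_val]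
  -- second factor
  have h2 : (𝐞 ((x : ℝ) * h / k) : ℂ) = ZMod.stdAddChar ((h : ZMod k) * (x : ZMod k)) := by
    rw [show (x : ℝ) * h = (((x * h : ℤ)) : ℝ) by push_cast; ring, e_intCast_div_eq_stdAddChar]
    congr 1
    push_cast
    ring
  rw [h1, h2, ← AddChar.map_add_eq_mul]
  congr 1
  ring


/-- A sum over the residues `δ mod k` with `(δ, k) = 1` is the sum over `0 ≤ x < k`, `(x, k) = 1`
(`k ≥ 1`). [folklore] -/
theorem sum_zmod_coprime_eq_sum_range {k : ℕ} [NeZero k] (F : ZMod k → ℂ) :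
    ∑ δ ∈ (Finset.univ : Finset (ZMod k)).filter (fun δ => δ.val.Coprime k), F δ =
      ∑ x ∈ (Finset.range k).filter (fun x => x.Coprime k), F x := by
  refine Finset.sum_bij' (fun δ _ => δ.val) (fun x _ => (x : ZMod k)) ?_ ?_ ?_ ?_ ?_
  · intro δ hδ
    rw [Finset.mem_filter] at hδ ⊢
    exact ⟨Finset.mem_range.2 (ZMod.val_lt δ), hδ.2⟩
  · intro x hx
    rw [Finset.mem_filter, Finset.mem_range] at hx
    rw [Finset.mem_filter]
    refine ⟨Finset.mem_univ _, ?_⟩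
    rw [ZMod.val_cast_of_lt hx.1]
    exact hx.2
  · intro δ _; exact ZMod.natCast_zmod_val δ
  · intro x hx
    rw [Finset.mem_filter, Finset.mem_range] at hx
    exact ZMod.val_cast_of_lt hx.1
  · intro δ _; rw [ZMod.natCast_zmod_val]

/-- **The complete sum is `kl`**: `∑_{(δ,k)=1} Ψ(δ) e(δ h/k) = 𝓢_k(h; n, r)`. [folklore] -/
theorem sum_psi_mul_e_eq_kl {k : ℕ} [NeZero k] (r : ℕ) (n h : ℤ) :
    ∑ δ ∈ (Finset.univ : Finset (ZMod k)).filter (fun δ => δ.val.Coprime k),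
      psi k r n δ * (𝐞 ((δ.val : ℝ) * h / k) : ℂ) = kl k r n h := by
  rw [sum_zmod_coprime_eq_sum_range]
  unfold kl psi
  refine Finset.sum_congr rfl fun x hx => ?_
  rw [Finset.mem_filter, Finset.mem_range] at hx
  rw [ZMod.val_cast_of_lt hx.1]
  push_cast
  rfl

/-- A sum over the residues `(δ, k) = 1` is a sum over the unit group `(ℤ/k)ˣ`. [folklore] -/
theorem sum_zmod_coprime_eq_sum_units {k : ℕ} [NeZero k] (F : ZMod k → ℂ) :
    ∑ δ ∈ (Finset.univ : Finset (ZMod k)).filter (fun δ => δ.val.Coprime k), F δ =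
      ∑ u : (ZMod k)ˣ, F (u : ZMod k) := by
  refine Finset.sum_bij' (fun δ hδ => ZMod.unitOfCoprime δ.val (Finset.mem_filter.1 hδ).2)
    (fun u _ => (u : ZMod k)) ?_ ?_ ?_ ?_ ?_
  · intro δ _; exact Finset.mem_univ _
  · intro u _
    rw [Finset.mem_filter]
    exact ⟨Finset.mem_univ _, ZMod.val_coe_unit_coprime u⟩
  · intro δ _
    rw [ZMod.coe_unitOfCoprime, ZMod.natCast_zmod_val]
  · intro u _
    ext
    rw [ZMod.coe_unitOfCoprime, ZMod.natCast_zmod_val]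
  · intro δ _
    rw [ZMod.coe_unitOfCoprime, ZMod.natCast_zmod_val]

/-- **The zero frequency is a Ramanujan sum**: for `(r, k) = 1`,
`∑_{(δ,k)=1} Ψ(δ) = ∑_{(δ,k)=1} e(n (rδ)‾/k) = c_k(n)` (the map `δ ↦ (rδ)‾` permutes the reduced
residues). [folklore] -/
theorem sum_psi_eq_ramanujanSum {k : ℕ} [NeZero k] {r : ℕ} (hr : r.Coprime k) (n : ℤ) :
    ∑ δ ∈ (Finset.univ : Finset (ZMod k)).filter (fun δ => δ.val.Coprime k), psi k r n δ =
      ramanujanSum k n := by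
  rw [sum_zmod_coprime_eq_sum_units]
  set ru : (ZMod k)ˣ := ZMod.unitOfCoprime r hr with hru
  -- `Ψ(u) = G((ru·u)⁻¹)` with `G(v) = e(n v/k)`
  set G : (ZMod k)ˣ → ℂ := fun v => (𝐞 ((n : ℝ) * (((v : ZMod k)).val : ℝ) / k) : ℂ) with hG
  have hΨ : ∀ u : (ZMod k)ˣ, psi k r n (u : ZMod k) = G ((ru * u)⁻¹) := by
    intro u
    simp only [psi, hG]
    congr 4
    rw [← ZMod.inv_coe_unit, Units.val_mul, hru, ZMod.coe_unitOfCoprime]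
  simp_rw [hΨ]
  -- reindex by the bijection `u ↦ (ru u)⁻¹`
  set e : (ZMod k)ˣ ≃ (ZMod k)ˣ := (Equiv.mulLeft ru).trans (Equiv.inv _) with he
  have hsum : ∑ u : (ZMod k)ˣ, G ((ru * u)⁻¹) = ∑ v : (ZMod k)ˣ, G v := by
    have := Equiv.sum_comp e G
    simpa [he] using this
  rw [hsum]
  -- back to residues, then to `0 ≤ a < k`
  have h2 := sum_zmod_coprime_eq_sum_units (k := k) (fun δ => (𝐞 ((n : ℝ) * ((δ.val : ℕ) : ℝ) / k) : ℂ))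
  simp only [hG]
  rw [← h2, sum_zmod_coprime_eq_sum_range, ramanujanSum]
  refine Finset.sum_congr rfl fun x hx => ?_
  rw [Finset.mem_filter, Finset.mem_range] at hx
  rw [ZMod.val_cast_of_lt hx.1]
  congr 2
  ring

/-- There are at most `k` reduced residues. [folklore] -/
theorem card_coprime_residues_le (k : ℕ) [NeZero k] :
    #((Finset.univ : Finset (ZMod k)).filter (fun δ => δ.val.Coprime k)) ≤ k := by
  calc #((Finset.univ : Finset (ZMod k)).filter (fun δ => δ.val.Coprime k))
      ≤ #(Finset.univ : Finset (ZMod k)) := Finset.card_filter_le _ _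
    _ = k := by rw [Finset.card_univ, ZMod.card]


/-! ### The congruence sums of `w(d/D)` and `classSum` -/

/-- `α(0) = 0` for the weight `α = bump (D/2) (D/4)`, `D > 0`. [folklore] -/
theorem bump_half_quarter_zero {D : ℝ} (hD : 0 < D) : bump (D / 2) (D / 4) 0 = 0 :=
  bump_eq_zero_of_le (by positivity) (by positivity) (by linarith)

/-- The sum of `w(d/D)` over `1 ≤ d ≤ ⌊5D/4⌋`, `d ≡ δ (mod k)`, is the congruence sum
`classSum (D/2) (D/4) k δ` of `…Theorem5Poisson` (the extra term `d = 0` there vanishes). [folklore] -/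
theorem sum_Icc_filter_bump_eq_classSum {D : ℝ} (hD : 0 < D) (k : ℕ) (δ : ZMod k) :
    ∑ d ∈ (Finset.Icc 1 ⌊5 / 4 * D⌋₊).filter (fun d : ℕ => (d : ZMod k) = δ),
      bump (D / 2) (D / 4) d = classSum (D / 2) (D / 4) k δ := by
  rw [classSum, mRange_half_quarter, Finset.sum_filter, Finset.sum_filter,
    Finset.sum_range_succ' _ ⌊5 / 4 * D⌋₊]
  simp only [Nat.cast_zero, bump_half_quarter_zero hD, ite_self, add_zero]
  rw [← Finset.Ico_add_one_right_eq_Icc, Finset.sum_Ico_eq_sum_range, Nat.add_sub_cancel]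
  refine Finset.sum_congr rfl fun i _ => ?_
  rw [add_comm]

/-- The fibre of `d ↦ d mod k` over a residue `δ` inside the `d` coprime to `k`: all of the class of
`δ` if `(δ, k) = 1`, empty otherwise. [folklore] -/
theorem filter_coprime_filter_eq {k : ℕ} [NeZero k] (T : Finset ℕ) (δ : ZMod k) :
    (T.filter (fun d : ℕ => d.Coprime k)).filter (fun d : ℕ => (d : ZMod k) = δ) =
      if δ.val.Coprime k then T.filter (fun d : ℕ => (d : ZMod k) = δ) else ∅ := by
  have key : ∀ d : ℕ, (d : ZMod k) = δ → (d.Coprime k ↔ δ.val.Coprime k) := by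
    intro d hd
    rw [← hd, ZMod.val_natCast, Nat.Coprime, Nat.Coprime, Nat.gcd_comm, ← Nat.gcd_rec, Nat.gcd_comm]
  split_ifs with hδ
  · ext d
    simp only [Finset.mem_filter]
    constructor
    · rintro ⟨⟨h1, _⟩, h3⟩; exact ⟨h1, h3⟩
    · rintro ⟨h1, h3⟩; exact ⟨⟨h1, (key d h3).2 hδ⟩, h3⟩
  · ext d
    simp only [Finset.mem_filter, Finset.notMem_empty, iff_false, not_and]
    rintro ⟨_, h2⟩ h3
    exact hδ ((key d h3).1 h2)

/-- `Ψ` is constant on residue classes: for `d ≡ δ (mod k)`, `e(n (rd)‾/k) = Ψ(δ)`. [folklore] -/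
theorem psi_natCast (k r d : ℕ) (n : ℤ) :
    (𝐞 ((n : ℝ) * (((((r * d : ℕ) : ZMod k))⁻¹).val : ℝ) / k) : ℂ) = psi k r n (d : ZMod k) := by
  unfold psi
  push_cast
  rfl

/-- **The inner sum over `d` as a sum over reduced residues of congruence sums**: for `(r, k) = 1`,
`∑_{d ≤ 5D/4, (rd,k)=1} w(d/D) e(n (rd)‾/k) = ∑_{(δ,k)=1} Ψ(δ) · A(k, δ)` with
`A(k, δ) = classSum (D/2) (D/4) k δ`. [folklore] -/
theorem inner_eq_sum_psi_classSum {D : ℝ} (hD : 0 < D) {k : ℕ} [NeZero k] {r : ℕ}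
    (hr : r.Coprime k) (n : ℤ) :
    ∑ d ∈ (Finset.Icc 1 ⌊5 / 4 * D⌋₊).filter (fun d => (r * d).Coprime k),
        ((bump (D / 2) (D / 4) d : ℝ) : ℂ) * psi k r n (d : ZMod k) =
      ∑ δ ∈ (Finset.univ : Finset (ZMod k)).filter (fun δ => δ.val.Coprime k),
        psi k r n δ * (classSum (D / 2) (D / 4) k δ : ℂ) := by
  have hfilter : (Finset.Icc 1 ⌊5 / 4 * D⌋₊).filter (fun d => (r * d).Coprime k) =
      (Finset.Icc 1 ⌊5 / 4 * D⌋₊).filter (fun d : ℕ => d.Coprime k) :=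
    Finset.filter_congr fun d _ => by
      rw [Nat.coprime_mul_iff_left]
      exact ⟨fun h => h.2, fun h => ⟨hr, h⟩⟩
  rw [hfilter]
  rw [← Finset.sum_fiberwise ((Finset.Icc 1 ⌊5 / 4 * D⌋₊).filter (fun d : ℕ => d.Coprime k))
    (fun d : ℕ => (d : ZMod k))
    (fun d : ℕ => ((bump (D / 2) (D / 4) d : ℝ) : ℂ) * psi k r n (d : ZMod k))]
  rw [← Finset.sum_filter_add_sum_filter_not Finset.univ (fun δ : ZMod k => δ.val.Coprime k)]
  have hzero : ∑ δ ∈ Finset.univ.filter (fun δ : ZMod k => ¬ δ.val.Coprime k),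
      ∑ d ∈ ((Finset.Icc 1 ⌊5 / 4 * D⌋₊).filter (fun d : ℕ => d.Coprime k)).filter
        (fun d : ℕ => (d : ZMod k) = δ),
        ((bump (D / 2) (D / 4) d : ℝ) : ℂ) * psi k r n (d : ZMod k) = 0 := by
    refine Finset.sum_eq_zero fun δ hδ => ?_
    rw [Finset.mem_filter] at hδ
    rw [filter_coprime_filter_eq, if_neg hδ.2, Finset.sum_empty]
  rw [hzero, add_zero]
  refine Finset.sum_congr rfl fun δ hδ => ?_
  rw [Finset.mem_filter] at hδ
  rw [filter_coprime_filter_eq, if_pos hδ.2]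
  rw [← sum_Icc_filter_bump_eq_classSum hD k δ, Complex.ofReal_sum, Finset.mul_sum]
  refine Finset.sum_congr rfl fun d hd => ?_
  rw [Finset.mem_filter] at hd
  rw [hd.2, mul_comm]

/-- **The oscillatory part**: `∑_{(δ,k)=1} Ψ(δ) · oscSum(k, δ, H₀) = ∑_{1 ≤ h ≤ H₀} (Φ_k(h) 𝓢_k(h) + Φ_k(−h) 𝓢_k(−h))`.
[folklore] -/
theorem sum_psi_mul_oscSum {D : ℝ} {k : ℕ} [NeZero k] (r : ℕ) (n : ℤ) (H₀ : ℕ) :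
    ∑ δ ∈ (Finset.univ : Finset (ZMod k)).filter (fun δ => δ.val.Coprime k),
        psi k r n δ * oscSum (D / 2) (D / 4) k δ H₀ =
      ∑ h ∈ Finset.Icc 1 H₀, (fcoef (D / 2) (D / 4) k h * kl k r n h +
        fcoef (D / 2) (D / 4) k (-(h : ℤ)) * kl k r n (-(h : ℤ))) := by
  unfold oscSum
  simp_rw [Finset.mul_sum]
  rw [Finset.sum_comm]
  refine Finset.sum_congr rfl fun h _ => ?_
  rw [← sum_psi_mul_e_eq_kl r n (h : ℤ), ← sum_psi_mul_e_eq_kl r n (-(h : ℤ)), Finset.mul_sum,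
    Finset.mul_sum, ← Finset.sum_add_distrib]
  refine Finset.sum_congr rfl fun δ _ => ?_
  unfold twCoef
  push_cast
  ring

/-- **Decomposition of the inner sum modulo `k`** (the first step of the proof of the corrected
Lemma 1 = Deshouillers–Iwaniec Theorem 12: Poisson summation in `d` in each reduced class modulo
`k = sc`): for `D > 0`, `k ≥ 1`, `H₀ ≥ 0`, `j ≥ 2`,
`‖∑_{d ≤ 5D/4, (rd,k)=1} w(d/D) e(n(rd)‾/k) − [(r,k)=1] k⁻¹ (α̂₀ c_k(n) + ∑_{1≤|h|≤H₀} Φ_k(h) 𝓢_k(h; n, r))‖ ≤ tailBound(D/4, j, k, H₀)`,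
where `α̂₀ = 𝓕α(0)`, `Φ_k(h) = 𝓕α(h/k)` for `α = w(·/D)`, `c_k(n)` is Ramanujan's sum and
`𝓢_k(h; n, r) = ∑_{(x,k)=1} e((n (rx)‾ + hx)/k)` the Kloosterman sum.
[cite: BombieriFriedlanderIwaniec2019, §2 (the corrected (9.11) of Deshouillers–Iwaniec)] -/
theorem norm_inner_sub_model_le {D : ℝ} (hD : 0 < D) {k : ℕ} (hk : 0 < k) (r : ℕ) (n : ℤ)
    (H₀ : ℕ) {j : ℕ} (hj : 2 ≤ j) :
    ‖(∑ d ∈ (Finset.Icc 1 ⌊5 / 4 * D⌋₊).filter (fun d => (r * d).Coprime k),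
        ((bump (D / 2) (D / 4) d : ℝ) : ℂ) * psi k r n (d : ZMod k)) -
      (if r.Coprime k then
        (k : ℂ)⁻¹ * (alphaHat (D / 2) (D / 4) * ramanujanSum k n +
          ∑ h ∈ Finset.Icc 1 H₀, (fcoef (D / 2) (D / 4) k h * kl k r n h +
            fcoef (D / 2) (D / 4) k (-(h : ℤ)) * kl k r n (-(h : ℤ))))
       else 0)‖ ≤ tailBound (D / 4) j k H₀ := by
  haveI : NeZero k := ⟨hk.ne'⟩
  have hY : (0 : ℝ) < D / 4 := by positivity
  have hYM : D / 4 ≤ D / 2 := by linarith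
  by_cases hr : r.Coprime k
  · rw [if_pos hr, inner_eq_sum_psi_classSum hD hr, ← sum_psi_eq_ramanujanSum hr n,
      ← sum_psi_mul_oscSum r n H₀, Finset.mul_sum, mul_add, Finset.mul_sum, Finset.mul_sum,
      ← Finset.sum_add_distrib, ← Finset.sum_sub_distrib]
    have hterm : ∀ δ ∈ (Finset.univ : Finset (ZMod k)).filter (fun δ => δ.val.Coprime k),
        ‖psi k r n δ * (classSum (D / 2) (D / 4) k δ : ℂ) -
          ((k : ℂ)⁻¹ * (alphaHat (D / 2) (D / 4) * psi k r n δ) +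
            (k : ℂ)⁻¹ * (psi k r n δ * oscSum (D / 2) (D / 4) k δ H₀))‖ ≤
          (k : ℝ)⁻¹ * tailBound (D / 4) j k H₀ := by
      intro δ _
      have h := norm_classSum_sub_le hY hYM hk δ H₀ hj
      calc ‖psi k r n δ * (classSum (D / 2) (D / 4) k δ : ℂ) -
            ((k : ℂ)⁻¹ * (alphaHat (D / 2) (D / 4) * psi k r n δ) +
              (k : ℂ)⁻¹ * (psi k r n δ * oscSum (D / 2) (D / 4) k δ H₀))‖
          = ‖psi k r n δ * ((classSum (D / 2) (D / 4) k δ : ℂ) -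
              (k : ℂ)⁻¹ * (alphaHat (D / 2) (D / 4) + oscSum (D / 2) (D / 4) k δ H₀))‖ := by
            congr 1; ring
        _ ≤ (k : ℝ)⁻¹ * tailBound (D / 4) j k H₀ := by
            rw [norm_mul, norm_psi, one_mul]; exact h
    refine (norm_sum_le _ _).trans ((Finset.sum_le_sum hterm).trans ?_)
    rw [Finset.sum_const, nsmul_eq_mul]
    have hk0 : (0 : ℝ) < k := by exact_mod_cast hk
    have ht0 := tailBound_nonneg hY j k H₀
    calc (#((Finset.univ : Finset (ZMod k)).filter (fun δ => δ.val.Coprime k)) : ℝ) *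
          ((k : ℝ)⁻¹ * tailBound (D / 4) j k H₀)
        ≤ (k : ℝ) * ((k : ℝ)⁻¹ * tailBound (D / 4) j k H₀) := by
          refine mul_le_mul_of_nonneg_right ?_ (by positivity)
          exact_mod_cast card_coprime_residues_le k
      _ = tailBound (D / 4) j k H₀ := by field_simp
  · rw [if_neg hr, sub_zero]
    have hempty : (Finset.Icc 1 ⌊5 / 4 * D⌋₊).filter (fun d => (r * d).Coprime k) = ∅ := by
      refine Finset.filter_eq_empty_iff.2 fun d _ h => hr ?_
      exact (Nat.coprime_mul_iff_left.1 h).1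
    rw [hempty, Finset.sum_empty, norm_zero]
    exact tailBound_nonneg hY j k H₀


/-! ### The decomposition `𝓚 = 𝓚₀ + 𝓚♯(H₀) + (tail)` for the weight `w ⊗ w` -/

/-- The inner `d`-sum of `𝓚` at `(r, s, c, n)` for the weight `g(c,d) = w(c/C) w(d/D)` (literally the
inner sum of `BFI.dispK`). [folklore] -/
def Tin (C D : ℝ) (dM : ℕ) (r s c n : ℕ) : ℂ :=
  ∑ d ∈ (Finset.Icc 1 dM).filter (fun d => (r * d).Coprime (s * c)),
    ((plateau2 (c / C) (d / D) : ℝ) : ℂ) *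
      (𝐞 ((n : ℝ) * (((((r * d : ℕ) : ZMod (s * c)))⁻¹.val : ℕ) : ℝ) / ((s * c : ℕ) : ℝ)) : ℂ)

/-- `𝓚` for the weight `w ⊗ w` in terms of `Tin`. [folklore] -/
theorem dispK_eq_sum_Tin (C D : ℝ) (cM dM N : ℕ) (R S : ℝ) (B : ℕ → ℕ → ℕ → ℂ) :
    dispK (fun c d => plateau2 (c / C) (d / D)) cM dM N R S B =
      ∑ r ∈ dyadic R, ∑ s ∈ dyadic S, ∑ n ∈ Finset.Icc 1 N, B n r s *
        ∑ c ∈ Finset.Icc 1 cM, Tin C D dM r s c n := rfl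

/-- The phase of `𝓚` is `Ψ` (natural-number frequency `n`). [folklore] -/
theorem phase_eq_psi (k r d n : ℕ) :
    (𝐞 ((n : ℝ) * ((((((r * d : ℕ) : ZMod k))⁻¹.val : ℕ) : ℝ)) / (k : ℝ)) : ℂ) =
      psi k r (n : ℤ) (d : ZMod k) := by
  rw [← psi_natCast]
  push_cast
  ring_nf

/-- `Tin = w(c/C) · ∑_d w(d/D) Ψ(d)` with the weight `α = bump (D/2) (D/4)` (`D > 0`). [folklore] -/
theorem Tin_eq {C D : ℝ} (hD : 0 < D) (r s c n : ℕ) :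
    Tin C D ⌊5 / 4 * D⌋₊ r s c n = ((plateau1 (c / C) : ℝ) : ℂ) *
      ∑ d ∈ (Finset.Icc 1 ⌊5 / 4 * D⌋₊).filter (fun d => (r * d).Coprime (s * c)),
        ((bump (D / 2) (D / 4) d : ℝ) : ℂ) * psi (s * c) r (n : ℤ) (d : ZMod (s * c)) := by
  unfold Tin
  rw [Finset.mul_sum]
  refine Finset.sum_congr rfl fun d _ => ?_
  rw [← phase_eq_psi (s * c) r d n, ← plateau1_div hD]
  unfold plateau2
  push_cast
  ring

/-- **The zero-frequency part `𝓚₀`** of `𝓚(C, D, N, R, S)` for the weight `w ⊗ w`: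
`𝓚₀ = ∑_{r∼R} ∑_{s∼S} ∑_{n≤N} B_{nrs} ∑_{c, (r,sc)=1} w(c/C) (sc)⁻¹ α̂₀ c_{sc}(n)` (`α̂₀ = ∫ w(t/D) dt`,
`c_{sc}(n)` Ramanujan's sum) — the term whose bound `≪ D(NR)^{1/2}‖B‖` (not `D(NR/S)^{1/2}‖B‖`) is the
corrected (9.11) of Deshouillers–Iwaniec. [cite: BombieriFriedlanderIwaniec2019, §2] -/
def Kzero (C D : ℝ) (N : ℕ) (R S : ℝ) (B : ℕ → ℕ → ℕ → ℂ) : ℂ :=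
  ∑ r ∈ dyadic R, ∑ s ∈ dyadic S, ∑ n ∈ Finset.Icc 1 N, B n r s *
    ∑ c ∈ (Finset.Icc 1 ⌊5 / 4 * C⌋₊).filter (fun c => r.Coprime (s * c)),
      ((plateau1 (c / C) : ℝ) : ℂ) * (((s * c : ℕ) : ℂ)⁻¹ *
        (alphaHat (D / 2) (D / 4) * ramanujanSum (s * c) n))

/-- **The off-diagonal part `𝓚♯(H₀)`** of `𝓚(C, D, N, R, S)` for the weight `w ⊗ w`: the frequencies
`1 ≤ |h| ≤ H₀` of the Poisson expansion, complete Kloosterman sums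
`𝓢_{sc}(h; n, r) = S(h, n r̄; sc)` against the Fourier coefficients `Φ_{sc}(±h) = 𝓕α(±h/sc)`,
`α = w(·/D)`:
`𝓚♯ = ∑_{r,s,n} B_{nrs} ∑_{c, (r,sc)=1} w(c/C)(sc)⁻¹ ∑_{1≤h≤H₀} (Φ_{sc}(h) 𝓢_{sc}(h;n,r) + Φ_{sc}(−h) 𝓢_{sc}(−h;n,r))`.
This is the quantity the spectral theory (Kuznetsov's formula, the large sieve) has to bound.
[cite: BombieriFriedlanderIwaniec2019, §2; BombieriFriedlanderIwaniecActa1986, §2 Lemma 1 p. 210] -/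
def Koff (C D : ℝ) (N : ℕ) (R S : ℝ) (H₀ : ℕ) (B : ℕ → ℕ → ℕ → ℂ) : ℂ :=
  ∑ r ∈ dyadic R, ∑ s ∈ dyadic S, ∑ n ∈ Finset.Icc 1 N, B n r s *
    ∑ c ∈ (Finset.Icc 1 ⌊5 / 4 * C⌋₊).filter (fun c => r.Coprime (s * c)),
      ((plateau1 (c / C) : ℝ) : ℂ) * (((s * c : ℕ) : ℂ)⁻¹ *
        ∑ h ∈ Finset.Icc 1 H₀, (fcoef (D / 2) (D / 4) (s * c) h * kl (s * c) r n h +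
          fcoef (D / 2) (D / 4) (s * c) (-(h : ℤ)) * kl (s * c) r n (-(h : ℤ))))

/-- The `c`-sums at one `(r, s, n)`: `∑_c Tin − (zero part) − (off-diagonal part)` is bounded by the
sum of the Poisson tails. [folklore] -/
theorem norm_csum_sub_le {C D : ℝ} (hD : 0 < D) {r s : ℕ} (hs : 0 < s) (n H₀ : ℕ) {j : ℕ}
    (hj : 2 ≤ j) :
    ‖(∑ c ∈ Finset.Icc 1 ⌊5 / 4 * C⌋₊, Tin C D ⌊5 / 4 * D⌋₊ r s c n) -
      (∑ c ∈ (Finset.Icc 1 ⌊5 / 4 * C⌋₊).filter (fun c => r.Coprime (s * c)),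
        ((plateau1 (c / C) : ℝ) : ℂ) * (((s * c : ℕ) : ℂ)⁻¹ *
          (alphaHat (D / 2) (D / 4) * ramanujanSum (s * c) n))) -
      (∑ c ∈ (Finset.Icc 1 ⌊5 / 4 * C⌋₊).filter (fun c => r.Coprime (s * c)),
        ((plateau1 (c / C) : ℝ) : ℂ) * (((s * c : ℕ) : ℂ)⁻¹ *
          ∑ h ∈ Finset.Icc 1 H₀, (fcoef (D / 2) (D / 4) (s * c) h * kl (s * c) r n h +
            fcoef (D / 2) (D / 4) (s * c) (-(h : ℤ)) * kl (s * c) r n (-(h : ℤ)))))‖ ≤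
      ∑ c ∈ Finset.Icc 1 ⌊5 / 4 * C⌋₊, tailBound (D / 4) j (s * c) H₀ := by
  rw [Finset.sum_filter, Finset.sum_filter, ← Finset.sum_sub_distrib, ← Finset.sum_sub_distrib]
  refine (norm_sum_le _ _).trans (Finset.sum_le_sum fun c hc => ?_)
  have hc : 0 < c := (Finset.mem_Icc.1 hc).1
  have hk : 0 < s * c := Nat.mul_pos hs hc
  have key := norm_inner_sub_model_le hD hk r (n : ℤ) H₀ hj
  rw [Tin_eq hD]
  set T := ∑ d ∈ (Finset.Icc 1 ⌊5 / 4 * D⌋₊).filter (fun d => (r * d).Coprime (s * c)),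
    ((bump (D / 2) (D / 4) d : ℝ) : ℂ) * psi (s * c) r (n : ℤ) (d : ZMod (s * c)) with hT
  set Mo := ((s * c : ℕ) : ℂ)⁻¹ * (alphaHat (D / 2) (D / 4) * ramanujanSum (s * c) n +
    ∑ h ∈ Finset.Icc 1 H₀, (fcoef (D / 2) (D / 4) (s * c) h * kl (s * c) r n h +
      fcoef (D / 2) (D / 4) (s * c) (-(h : ℤ)) * kl (s * c) r n (-(h : ℤ)))) with hMo
  have hw0 : 0 ≤ plateau1 (c / C) := plateau_nonneg _
  have hw1 : plateau1 (c / C) ≤ 1 := plateau_le_one _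
  have hsplit : ((plateau1 (c / C) : ℝ) : ℂ) * T -
      (if r.Coprime (s * c) then ((plateau1 (c / C) : ℝ) : ℂ) * (((s * c : ℕ) : ℂ)⁻¹ *
        (alphaHat (D / 2) (D / 4) * ramanujanSum (s * c) n)) else 0) -
      (if r.Coprime (s * c) then ((plateau1 (c / C) : ℝ) : ℂ) * (((s * c : ℕ) : ℂ)⁻¹ *
        ∑ h ∈ Finset.Icc 1 H₀, (fcoef (D / 2) (D / 4) (s * c) h * kl (s * c) r n h +
          fcoef (D / 2) (D / 4) (s * c) (-(h : ℤ)) * kl (s * c) r n (-(h : ℤ)))) else 0) =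
      ((plateau1 (c / C) : ℝ) : ℂ) * (T - (if r.Coprime (s * c) then Mo else 0)) := by
    split_ifs with h
    · rw [hMo]; push_cast; ring
    · ring
  rw [hsplit, norm_mul, Complex.norm_real, Real.norm_eq_abs, abs_of_nonneg hw0]
  have hkey : ‖T - (if r.Coprime (s * c) then Mo else 0)‖ ≤ tailBound (D / 4) j (s * c) H₀ := by
    have e : (((s * c : ℕ) : ℂ))⁻¹ = ((s * c : ℕ) : ℂ)⁻¹ := rfl
    simpa [hT, hMo, Int.cast_natCast] using key
  calc plateau1 (c / C) * ‖T - (if r.Coprime (s * c) then Mo else 0)‖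
      ≤ 1 * tailBound (D / 4) j (s * c) H₀ :=
        mul_le_mul hw1 hkey (norm_nonneg _) zero_le_one
    _ = _ := one_mul _

/-- **`𝓚 = 𝓚₀ + 𝓚♯(H₀) + O(tails)`** for the weight `w ⊗ w`: for `D > 0`, `S ≥ 0` (so that
`s ≥ 1`), every `H₀ ≥ 0` and `j ≥ 2`,
`‖𝓚 − 𝓚₀ − 𝓚♯(H₀)‖ ≤ ∑_{r,s,n} |B_{nrs}| ∑_{c ≤ 5C/4} tailBound(D/4, j, sc, H₀)`.
[cite: BombieriFriedlanderIwaniec2019, §2] -/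
theorem norm_dispK_sub_Kzero_sub_Koff_le {C D : ℝ} (hD : 0 < D) (N : ℕ) (R : ℝ) {S : ℝ}
    (hS : 0 ≤ S) (H₀ : ℕ) {j : ℕ} (hj : 2 ≤ j) (B : ℕ → ℕ → ℕ → ℂ) :
    ‖dispK (fun c d => plateau2 (c / C) (d / D)) ⌊5 / 4 * C⌋₊ ⌊5 / 4 * D⌋₊ N R S B -
        Kzero C D N R S B - Koff C D N R S H₀ B‖ ≤
      ∑ r ∈ dyadic R, ∑ s ∈ dyadic S, ∑ n ∈ Finset.Icc 1 N, ‖B n r s‖ *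
        ∑ c ∈ Finset.Icc 1 ⌊5 / 4 * C⌋₊, tailBound (D / 4) j (s * c) H₀ := by
  rw [dispK_eq_sum_Tin]
  unfold Kzero Koff
  rw [← Finset.sum_sub_distrib, ← Finset.sum_sub_distrib]
  refine (norm_sum_le _ _).trans (Finset.sum_le_sum fun r _ => ?_)
  rw [← Finset.sum_sub_distrib, ← Finset.sum_sub_distrib]
  refine (norm_sum_le _ _).trans (Finset.sum_le_sum fun s hs' => ?_)
  have hs : 0 < s := pos_of_mem_dyadic hS hs'
  rw [← Finset.sum_sub_distrib, ← Finset.sum_sub_distrib]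
  refine (norm_sum_le _ _).trans (Finset.sum_le_sum fun n _ => ?_)
  rw [← mul_sub, ← mul_sub, norm_mul]
  exact mul_le_mul_of_nonneg_left (norm_csum_sub_le hD hs n H₀ hj) (norm_nonneg _)


/-! ### The zero frequency: `‖𝓚₀‖ ≪ (CDNRS)^η · D (NR)^{1/2} ‖B‖` (the corrected (9.11)) -/

/-- **`|c_q(n)| ≤ τ(n) · (q, n)`** for `n ≥ 1` (Kluyver: `c_q(n) = ∑_{d ∣ (q,n)} d μ(q/d)`, at most `τ(n)`
terms each `≤ (q, n)`). [folklore] -/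
theorem norm_ramanujanSum_le_mul_gcd (q : ℕ) {n : ℕ} (hn : n ≠ 0) :
    ‖ramanujanSum q n‖ ≤ (#n.divisors : ℝ) * (Nat.gcd q n : ℝ) := by
  rcases Nat.eq_zero_or_pos q with rfl | hq
  · simp only [ramanujanSum_zero, norm_zero]; positivity
  rw [ramanujanSum_eq_ramanujanDivisorSum, Int.natAbs_natCast, Complex.norm_intCast,
    ramanujanDivisorSum_apply]
  push_cast [Int.cast_sum, Int.cast_mul]
  refine (Finset.abs_sum_le_sum_abs _ _).trans ?_
  have hterm : ∀ x ∈ q.divisorsAntidiagonal,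
      |((ArithmeticFunction.moebius x.1 : ℤ) : ℝ) * (if x.2 ∣ n then (x.2 : ℝ) else 0)| ≤
        if x.2 ∣ n then (Nat.gcd q n : ℝ) else 0 := by
    intro x hx
    rw [Nat.mem_divisorsAntidiagonal] at hx
    rw [abs_mul]
    have hμ : |((ArithmeticFunction.moebius x.1 : ℤ) : ℝ)| ≤ 1 := by
      have := ArithmeticFunction.abs_moebius_le_one (n := x.1)
      exact_mod_cast this
    split_ifs with hd
    · rw [Nat.abs_cast]
      have hle : (x.2 : ℝ) ≤ Nat.gcd q n := by
        have h2 : x.2 ∣ q := ⟨x.1, by rw [mul_comm]; exact hx.1.symm⟩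
        exact_mod_cast Nat.le_of_dvd (Nat.gcd_pos_of_pos_right _ (Nat.pos_of_ne_zero hn))
          (Nat.dvd_gcd h2 hd)
      calc |((ArithmeticFunction.moebius x.1 : ℤ) : ℝ)| * (x.2 : ℝ) ≤ 1 * Nat.gcd q n :=
            mul_le_mul hμ hle (Nat.cast_nonneg _) zero_le_one
        _ = _ := one_mul _
    · simp
  refine (Finset.sum_le_sum hterm).trans ?_
  rw [← Finset.sum_filter, Finset.sum_const, nsmul_eq_mul]
  refine mul_le_mul_of_nonneg_right ?_ (Nat.cast_nonneg _)
  -- `#{(x₁,x₂) : x₁x₂ = q, x₂ ∣ n} ≤ τ(n)` via `x ↦ x₂`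
  have hinj : Set.InjOn (fun x : ℕ × ℕ => x.2)
      ((q.divisorsAntidiagonal.filter (fun x : ℕ × ℕ => x.2 ∣ n)) : Set (ℕ × ℕ)) := by
    intro x hx y hy hxy
    simp only [Finset.coe_filter, Set.mem_setOf_eq, Nat.mem_divisorsAntidiagonal] at hx hy
    have hx2 : x.2 ≠ 0 := by
      intro h; apply hq.ne'; rw [← hx.1.1, h, mul_zero]
    have h1 : x.1 = y.1 := by
      have e : x.1 * x.2 = y.1 * x.2 := by rw [hx.1.1, show x.2 = y.2 from hxy, hy.1.1]
      exact Nat.eq_of_mul_eq_mul_right (Nat.pos_of_ne_zero hx2) e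
    exact Prod.ext h1 hxy
  have hmaps : ∀ x ∈ q.divisorsAntidiagonal.filter (fun x : ℕ × ℕ => x.2 ∣ n),
      (fun x : ℕ × ℕ => x.2) x ∈ n.divisors := by
    intro x hx
    rw [Finset.mem_filter] at hx
    exact Nat.mem_divisors.2 ⟨hx.2, hn⟩
  exact_mod_cast Finset.card_le_card_of_injOn _ hmaps hinj

/-- `(sc, n) ≤ (s, n)(c, n)`. [folklore] -/
theorem gcd_mul_le (s c n : ℕ) (hn : n ≠ 0) :
    (Nat.gcd (s * c) n : ℝ) ≤ (Nat.gcd n s : ℝ) * (Nat.gcd n c : ℝ) := by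
  have h := Nat.gcd_mul_right_dvd_mul_gcd n s c
  rw [Nat.gcd_comm (s * c) n]
  have hpos : 0 < Nat.gcd n s * Nat.gcd n c :=
    Nat.mul_pos (Nat.gcd_pos_of_pos_left _ (Nat.pos_of_ne_zero hn))
      (Nat.gcd_pos_of_pos_left _ (Nat.pos_of_ne_zero hn))
  exact_mod_cast Nat.le_of_dvd hpos h

/-- **The `c`-sum of the zero frequency**: for `n, s ≥ 1`,
`∑_{1 ≤ c ≤ X} |c_{sc}(n)|/(sc) ≤ τ(n)² (1 + log X) (n, s)/s`. [folklore] -/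
theorem sum_norm_ramanujanSum_div_le {n s : ℕ} (hn : n ≠ 0) (hs : 0 < s) (X : ℕ) :
    ∑ c ∈ Finset.Icc 1 X, ‖ramanujanSum (s * c) n‖ / ((s * c : ℕ) : ℝ) ≤
      (#n.divisors : ℝ) ^ 2 * (1 + Real.log X) * ((Nat.gcd n s : ℝ) / s) := by
  have hs0 : (0 : ℝ) < s := by exact_mod_cast hs
  have hterm : ∀ c ∈ Finset.Icc 1 X, ‖ramanujanSum (s * c) n‖ / ((s * c : ℕ) : ℝ) ≤
      (#n.divisors : ℝ) * ((Nat.gcd n s : ℝ) / s) * ((Nat.gcd n c : ℝ) / c) := by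
    intro c hc
    have hc0 : (0 : ℝ) < c := by exact_mod_cast (Finset.mem_Icc.1 hc).1
    rw [div_le_iff₀ (by push_cast; positivity)]
    calc ‖ramanujanSum (s * c) n‖ ≤ (#n.divisors : ℝ) * (Nat.gcd (s * c) n : ℝ) :=
          norm_ramanujanSum_le_mul_gcd _ hn
      _ ≤ (#n.divisors : ℝ) * ((Nat.gcd n s : ℝ) * (Nat.gcd n c : ℝ)) :=
          mul_le_mul_of_nonneg_left (gcd_mul_le s c n hn) (Nat.cast_nonneg _)
      _ = (#n.divisors : ℝ) * ((Nat.gcd n s : ℝ) / s) * ((Nat.gcd n c : ℝ) / c) * ((s * c : ℕ) : ℝ) := by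
          push_cast; field_simp
  refine (Finset.sum_le_sum hterm).trans ?_
  rw [← Finset.mul_sum]
  have hg := L7.sum_gcd_div_le hn X
  have h0 : 0 ≤ (#n.divisors : ℝ) * ((Nat.gcd n s : ℝ) / s) := by positivity
  calc (#n.divisors : ℝ) * ((Nat.gcd n s : ℝ) / s) * ∑ c ∈ Finset.Icc 1 X, (Nat.gcd n c : ℝ) / c
      ≤ (#n.divisors : ℝ) * ((Nat.gcd n s : ℝ) / s) * ((#n.divisors : ℝ) * (1 + Real.log X)) :=
        mul_le_mul_of_nonneg_left hg h0
    _ = _ := by ring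

/-- **`𝓚₀` termwise**: `‖𝓚₀‖ ≤ D ∑_{r,s,n} |B_{nrs}| ∑_{c ≤ 5C/4} |c_{sc}(n)|/(sc)` (`|α̂₀| ≤ D`,
`0 ≤ w ≤ 1`). [folklore] -/
theorem norm_Kzero_le_sum {C D : ℝ} (hD : 0 < D) (N : ℕ) (R S : ℝ) (B : ℕ → ℕ → ℕ → ℂ) :
    ‖Kzero C D N R S B‖ ≤ D * ∑ r ∈ dyadic R, ∑ s ∈ dyadic S, ∑ n ∈ Finset.Icc 1 N, ‖B n r s‖ *
      ∑ c ∈ Finset.Icc 1 ⌊5 / 4 * C⌋₊, ‖ramanujanSum (s * c) n‖ / ((s * c : ℕ) : ℝ) := by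
  have hY : (0 : ℝ) < D / 4 := by positivity
  have hM : (0 : ℝ) ≤ D / 2 := by positivity
  have hα : ‖alphaHat (D / 2) (D / 4)‖ ≤ D := by
    have h := norm_fourier_bumpC_le hY hM 0
    rw [alphaHat]
    linarith
  unfold Kzero
  rw [Finset.mul_sum]
  refine (norm_sum_le _ _).trans (Finset.sum_le_sum fun r _ => ?_)
  rw [Finset.mul_sum]
  refine (norm_sum_le _ _).trans (Finset.sum_le_sum fun s _ => ?_)
  rw [Finset.mul_sum]
  refine (norm_sum_le _ _).trans (Finset.sum_le_sum fun n _ => ?_)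
  rw [norm_mul, mul_left_comm]
  refine mul_le_mul_of_nonneg_left ?_ (norm_nonneg _)
  refine (norm_sum_le _ _).trans ?_
  rw [Finset.mul_sum]
  refine (Finset.sum_le_sum_of_subset_of_nonneg (Finset.filter_subset _ _)
    (fun c _ _ => norm_nonneg _)).trans (Finset.sum_le_sum fun c hc => ?_)
  have hw0 : 0 ≤ plateau1 (c / C) := plateau_nonneg _
  have hw1 : plateau1 (c / C) ≤ 1 := plateau_le_one _
  rw [norm_mul, norm_mul, norm_mul, norm_inv, Complex.norm_natCast, Complex.norm_real,
    Real.norm_eq_abs, abs_of_nonneg hw0]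
  have hsc : 0 ≤ ((s * c : ℕ) : ℝ)⁻¹ := by positivity
  calc plateau1 (c / C) * (((s * c : ℕ) : ℝ)⁻¹ * (‖alphaHat (D / 2) (D / 4)‖ * ‖ramanujanSum (s * c) n‖))
      ≤ 1 * (((s * c : ℕ) : ℝ)⁻¹ * (D * ‖ramanujanSum (s * c) n‖)) := by
        gcongr
    _ = D * (‖ramanujanSum (s * c) n‖ / ((s * c : ℕ) : ℝ)) := by ring

/-- Cauchy's inequality for a triple sum: `∑∑∑ f g ≤ (∑∑∑ f²)^{1/2} (∑∑∑ g²)^{1/2}`. [folklore] -/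
theorem sum3_mul_le_sqrt_mul_sqrt (X Y Z : Finset ℕ) (f g : ℕ → ℕ → ℕ → ℝ) :
    ∑ x ∈ X, ∑ y ∈ Y, ∑ z ∈ Z, f x y z * g x y z ≤
      Real.sqrt (∑ x ∈ X, ∑ y ∈ Y, ∑ z ∈ Z, f x y z ^ 2) *
        Real.sqrt (∑ x ∈ X, ∑ y ∈ Y, ∑ z ∈ Z, g x y z ^ 2) := by
  have e : ∀ F : ℕ → ℕ → ℕ → ℝ, ∑ x ∈ X, ∑ y ∈ Y, ∑ z ∈ Z, F x y z =
      ∑ p ∈ X ×ˢ (Y ×ˢ Z), F p.1 p.2.1 p.2.2 := by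
    intro F
    rw [Finset.sum_product]
    refine Finset.sum_congr rfl fun x _ => ?_
    rw [Finset.sum_product]
  rw [e, e, e, ← Real.sqrt_mul (Finset.sum_nonneg fun _ _ => sq_nonneg _)]
  refine Real.le_sqrt_of_sq_le ?_
  exact Finset.sum_mul_sq_le_sq_mul_sq _ _ _

/-- `∑_{s ∼ S} (n,s)²/s² · ≤ τ(n)(1 + log 2S)`-type bound: `∑_{s∼S} ((n,s)/s)² ≤ τ(n)(1 + log⌊2S⌋)`
(`(n,s)/s ≤ 1` and `L7.sum_gcd_div_le`). [folklore] -/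
theorem sum_dyadic_gcd_div_sq_le {n : ℕ} (hn : n ≠ 0) {S : ℝ} (hS : 0 ≤ S) :
    ∑ s ∈ dyadic S, ((Nat.gcd n s : ℝ) / s) ^ 2 ≤ (#n.divisors : ℝ) * (1 + Real.log (⌊2 * S⌋₊ : ℕ)) := by
  have hsub : dyadic S ⊆ Finset.Icc 1 ⌊2 * S⌋₊ := by
    intro s hs
    have h := (mem_dyadic hS).1 hs
    rw [Finset.mem_Icc]
    exact ⟨pos_of_mem_dyadic hS hs, Nat.le_floor h.2⟩
  calc ∑ s ∈ dyadic S, ((Nat.gcd n s : ℝ) / s) ^ 2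
      ≤ ∑ s ∈ Finset.Icc 1 ⌊2 * S⌋₊, ((Nat.gcd n s : ℝ) / s) ^ 2 :=
        Finset.sum_le_sum_of_subset_of_nonneg hsub fun _ _ _ => sq_nonneg _
    _ ≤ ∑ s ∈ Finset.Icc 1 ⌊2 * S⌋₊, (Nat.gcd n s : ℝ) / s := by
        refine Finset.sum_le_sum fun s hs => ?_
        have hs1 : 1 ≤ s := (Finset.mem_Icc.1 hs).1
        have hs0 : (0 : ℝ) < s := by exact_mod_cast hs1
        have hle : (Nat.gcd n s : ℝ) / s ≤ 1 := by
          rw [div_le_one hs0]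
          exact_mod_cast Nat.le_of_dvd hs1 (Nat.gcd_dvd_right n s)
        have h0 : 0 ≤ (Nat.gcd n s : ℝ) / s := by positivity
        nlinarith
    _ ≤ _ := L7.sum_gcd_div_le hn _

/-- **The zero frequency is `≪ (CDNRS)^η D (NR)^{1/2} ‖B‖`** — the corrected bound (9.11) of
Deshouillers–Iwaniec for the first step of the proof of their Theorem 12 (BFI 2019, §2: "the quantity
`D(NR/S)^{1/2}` needs to be replaced by `D(NR)^{1/2}`"), here for the weight `w ⊗ w` and the ranges
`C, D, N ≥ 1`, `R, S ≥ 1/2`: for every `η > 0` there is `K₀` with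
`‖𝓚₀‖ ≤ K₀ (CDNRS)^η D (NR)^{1/2} ‖B‖`. [cite: BombieriFriedlanderIwaniec2019, §2] -/
theorem norm_Kzero_le {η : ℝ} (hη : 0 < η) :
    ∃ K₀ : ℝ, ∀ C D N R S : ℝ, 1 ≤ C → 1 ≤ D → 1 ≤ N → 1 / 2 ≤ R → 1 / 2 ≤ S →
      ∀ B : ℕ → ℕ → ℕ → ℂ,
        ‖Kzero C D ⌊N⌋₊ R S B‖ ≤
          K₀ * (C * D * N * R * S) ^ η * (D * Real.sqrt (N * R)) * lemma1Norm ⌊N⌋₊ R S B := by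
  -- divisor bound at exponent `δ = η/5`
  set δ : ℝ := η / 5 with hδ
  have hδ0 : 0 < δ := by positivity
  obtain ⟨Cδ, hCδ1, hτ⟩ := exists_card_divisors_le_mul_rpow' hδ0
  have hCδ0 : 0 ≤ Cδ := by linarith
  -- the constant
  refine ⟨2 * Cδ ^ 3 * (1 + 1 / δ) ^ 2 * 8 ^ η, ?_⟩
  intro C D N R S hC hD hN hR hS B
  have hD0 : 0 < D := by linarith
  have hS0 : 0 ≤ S := by linarith
  have hR0 : 0 ≤ R := by linarith
  set N' : ℕ := ⌊N⌋₊ with hN'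
  have hN'le : (N' : ℝ) ≤ N := Nat.floor_le (by linarith)
  set X : ℕ := ⌊5 / 4 * C⌋₊ with hX
  -- Step 1: termwise
  have h1 := norm_Kzero_le_sum (C := C) hD0 N' R S B
  -- Step 2: the inner `c`-sums
  set a : ℕ → ℕ → ℝ := fun n s => ∑ c ∈ Finset.Icc 1 X, ‖ramanujanSum (s * c) n‖ / ((s * c : ℕ) : ℝ)
    with ha
  have ha_le : ∀ n ∈ Finset.Icc 1 N', ∀ s ∈ dyadic S,
      a n s ≤ (#n.divisors : ℝ) ^ 2 * (1 + Real.log X) * ((Nat.gcd n s : ℝ) / s) := by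
    intro n hn s hs
    exact sum_norm_ramanujanSum_div_le (Nat.pos_of_ne_zero (by
      have := (Finset.mem_Icc.1 hn).1; omega)).ne' (pos_of_mem_dyadic hS0 hs) X
  have ha0 : ∀ n s, 0 ≤ a n s := fun n s => Finset.sum_nonneg fun _ _ => by positivity
  -- Step 3: Cauchy–Schwarz
  have hCS := sum3_mul_le_sqrt_mul_sqrt (dyadic R) (dyadic S) (Finset.Icc 1 N')
    (fun r s n => ‖B n r s‖) (fun r s n => a n s)
  have hnormB : Real.sqrt (∑ r ∈ dyadic R, ∑ s ∈ dyadic S, ∑ n ∈ Finset.Icc 1 N', ‖B n r s‖ ^ 2) =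
      lemma1Norm N' R S B := rfl
  -- Step 4: the sum of `a²`
  have hlogX : 0 ≤ 1 + Real.log X := by
    have : 0 ≤ Real.log (X : ℝ) := Real.log_natCast_nonneg X
    linarith
  have hlog2S : 0 ≤ 1 + Real.log (⌊2 * S⌋₊ : ℕ) := by
    have : 0 ≤ Real.log ((⌊2 * S⌋₊ : ℕ) : ℝ) := Real.log_natCast_nonneg _
    linarith
  have hτN : ∀ n ∈ Finset.Icc 1 N', (#n.divisors : ℝ) ≤ Cδ * N ^ δ := by
    intro n hn
    have hnN : (n : ℝ) ≤ N := le_trans (by exact_mod_cast (Finset.mem_Icc.1 hn).2) hN'le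
    calc (#n.divisors : ℝ) ≤ Cδ * (n : ℝ) ^ δ := hτ n
      _ ≤ Cδ * N ^ δ := mul_le_mul_of_nonneg_left (Real.rpow_le_rpow (Nat.cast_nonneg _) hnN hδ0.le) hCδ0
  have ha2 : ∑ r ∈ dyadic R, ∑ s ∈ dyadic S, ∑ n ∈ Finset.Icc 1 N', a n s ^ 2 ≤
      (2 * R + 1) * (N * ((Cδ * N ^ δ) ^ 5 * (1 + Real.log X) ^ 2 * (1 + Real.log (⌊2 * S⌋₊ : ℕ)))) := by
    have hinner : ∀ r ∈ dyadic R, ∑ s ∈ dyadic S, ∑ n ∈ Finset.Icc 1 N', a n s ^ 2 ≤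
        N * ((Cδ * N ^ δ) ^ 5 * (1 + Real.log X) ^ 2 * (1 + Real.log (⌊2 * S⌋₊ : ℕ))) := by
      intro r _
      rw [Finset.sum_comm]
      have hn1 : ∀ n ∈ Finset.Icc 1 N', ∑ s ∈ dyadic S, a n s ^ 2 ≤
          (Cδ * N ^ δ) ^ 5 * (1 + Real.log X) ^ 2 * (1 + Real.log (⌊2 * S⌋₊ : ℕ)) := by
        intro n hn
        have hn0 : n ≠ 0 := by have := (Finset.mem_Icc.1 hn).1; omega
        have hτn := hτN n hn
        have hτ0 : 0 ≤ (#n.divisors : ℝ) := Nat.cast_nonneg _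
        calc ∑ s ∈ dyadic S, a n s ^ 2
            ≤ ∑ s ∈ dyadic S, ((#n.divisors : ℝ) ^ 2 * (1 + Real.log X)) ^ 2 *
                ((Nat.gcd n s : ℝ) / s) ^ 2 := by
              refine Finset.sum_le_sum fun s hs => ?_
              have h := ha_le n hn s hs
              have h0 := ha0 n s
              calc a n s ^ 2 ≤ ((#n.divisors : ℝ) ^ 2 * (1 + Real.log X) * ((Nat.gcd n s : ℝ) / s)) ^ 2 :=
                    pow_le_pow_left₀ h0 h 2
                _ = _ := by ring
          _ = ((#n.divisors : ℝ) ^ 2 * (1 + Real.log X)) ^ 2 *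
                ∑ s ∈ dyadic S, ((Nat.gcd n s : ℝ) / s) ^ 2 := by rw [Finset.mul_sum]
          _ ≤ ((#n.divisors : ℝ) ^ 2 * (1 + Real.log X)) ^ 2 *
                ((#n.divisors : ℝ) * (1 + Real.log (⌊2 * S⌋₊ : ℕ))) :=
              mul_le_mul_of_nonneg_left (sum_dyadic_gcd_div_sq_le hn0 hS0) (by positivity)
          _ = (#n.divisors : ℝ) ^ 5 * (1 + Real.log X) ^ 2 * (1 + Real.log (⌊2 * S⌋₊ : ℕ)) := by ring
          _ ≤ (Cδ * N ^ δ) ^ 5 * (1 + Real.log X) ^ 2 * (1 + Real.log (⌊2 * S⌋₊ : ℕ)) := by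
              gcongr
      calc ∑ n ∈ Finset.Icc 1 N', ∑ s ∈ dyadic S, a n s ^ 2
          ≤ ∑ n ∈ Finset.Icc 1 N', (Cδ * N ^ δ) ^ 5 * (1 + Real.log X) ^ 2 *
              (1 + Real.log (⌊2 * S⌋₊ : ℕ)) := Finset.sum_le_sum hn1
        _ = (N' : ℝ) * ((Cδ * N ^ δ) ^ 5 * (1 + Real.log X) ^ 2 * (1 + Real.log (⌊2 * S⌋₊ : ℕ))) := by
            rw [Finset.sum_const, Nat.card_Icc, Nat.add_sub_cancel, nsmul_eq_mul]
        _ ≤ N * ((Cδ * N ^ δ) ^ 5 * (1 + Real.log X) ^ 2 * (1 + Real.log (⌊2 * S⌋₊ : ℕ))) :=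
            mul_le_mul_of_nonneg_right hN'le (by positivity)
    calc ∑ r ∈ dyadic R, ∑ s ∈ dyadic S, ∑ n ∈ Finset.Icc 1 N', a n s ^ 2
        ≤ ∑ r ∈ dyadic R, N * ((Cδ * N ^ δ) ^ 5 * (1 + Real.log X) ^ 2 * (1 + Real.log (⌊2 * S⌋₊ : ℕ))) :=
          Finset.sum_le_sum hinner
      _ = (#(dyadic R) : ℝ) * (N * ((Cδ * N ^ δ) ^ 5 * (1 + Real.log X) ^ 2 *
            (1 + Real.log (⌊2 * S⌋₊ : ℕ)))) := by rw [Finset.sum_const, nsmul_eq_mul]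
      _ ≤ (2 * R + 1) * (N * ((Cδ * N ^ δ) ^ 5 * (1 + Real.log X) ^ 2 *
            (1 + Real.log (⌊2 * S⌋₊ : ℕ)))) :=
          mul_le_mul_of_nonneg_right (card_dyadic_le hR0) (by positivity)
  -- Step 5: logarithms, and everything but `√(RN)` into one factor `W`
  have hlogX' : 1 + Real.log X ≤ (1 + 1 / δ) * (2 * C) ^ δ := by
    refine L7.one_add_log_le_rpow (by linarith) ?_ hδ0
    calc ((X : ℕ) : ℝ) ≤ 5 / 4 * C := Nat.floor_le (by linarith)
      _ ≤ 2 * C := by linarith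
  have hlog2S' : 1 + Real.log (⌊2 * S⌋₊ : ℕ) ≤ (1 + 1 / δ) * (2 * S) ^ δ :=
    L7.one_add_log_le_rpow (by linarith) (Nat.floor_le (by linarith)) hδ0
  set W : ℝ := (Cδ * N ^ δ) ^ 3 * (1 + 1 / δ) ^ 2 * (2 * C) ^ δ * (2 * S) ^ δ with hW
  have hNδ1 : 1 ≤ N ^ δ := Real.one_le_rpow hN hδ0.le
  have hCN1 : 1 ≤ Cδ * N ^ δ := one_le_mul_of_one_le_of_one_le hCδ1 hNδ1
  have hd1 : (1 : ℝ) ≤ 1 + 1 / δ := le_add_of_nonneg_right (by positivity)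
  have h2S1 : 1 ≤ (2 * S) ^ δ := Real.one_le_rpow (by linarith) hδ0.le
  have h2C0 : 0 ≤ (2 * C) ^ δ := Real.rpow_nonneg (by linarith) _
  have hW0 : 0 ≤ W := by positivity
  clear_value W
  have hT : (Cδ * N ^ δ) ^ 5 * (1 + Real.log X) ^ 2 * (1 + Real.log (⌊2 * S⌋₊ : ℕ)) ≤ W ^ 2 := by
    have hA : (1 + Real.log X) ^ 2 ≤ ((1 + 1 / δ) * (2 * C) ^ δ) ^ 2 := pow_le_pow_left₀ hlogX hlogX' 2
    have hCN0 : 0 ≤ (Cδ * N ^ δ) ^ 5 := by positivity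
    have hmid : 1 ≤ (1 + 1 / δ) * (2 * S) ^ δ := one_le_mul_of_one_le_of_one_le hd1 h2S1
    calc (Cδ * N ^ δ) ^ 5 * (1 + Real.log X) ^ 2 * (1 + Real.log (⌊2 * S⌋₊ : ℕ))
        ≤ (Cδ * N ^ δ) ^ 5 * ((1 + 1 / δ) * (2 * C) ^ δ) ^ 2 * ((1 + 1 / δ) * (2 * S) ^ δ) :=
          mul_le_mul (mul_le_mul_of_nonneg_left hA hCN0) hlog2S' hlog2S (by positivity)
      _ ≤ (Cδ * N ^ δ) ^ 6 * ((1 + 1 / δ) * (2 * C) ^ δ) ^ 2 * ((1 + 1 / δ) * (2 * S) ^ δ) ^ 2 := by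
          refine mul_le_mul (mul_le_mul_of_nonneg_right (pow_le_pow_right₀ hCN1 (by norm_num))
            (by positivity)) (le_self_pow₀ hmid two_ne_zero) (by positivity) (by positivity)
      _ = W ^ 2 := by rw [hW]; ring
  have ha2' : ∑ r ∈ dyadic R, ∑ s ∈ dyadic S, ∑ n ∈ Finset.Icc 1 N', a n s ^ 2 ≤
      (2 * Real.sqrt (R * N) * W) ^ 2 := by
    have hRN : Real.sqrt (R * N) ^ 2 = R * N := Real.sq_sqrt (by positivity)
    have hT0 : 0 ≤ (Cδ * N ^ δ) ^ 5 * (1 + Real.log X) ^ 2 * (1 + Real.log (⌊2 * S⌋₊ : ℕ)) := by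
      positivity
    calc ∑ r ∈ dyadic R, ∑ s ∈ dyadic S, ∑ n ∈ Finset.Icc 1 N', a n s ^ 2
        ≤ (2 * R + 1) * (N * ((Cδ * N ^ δ) ^ 5 * (1 + Real.log X) ^ 2 * (1 + Real.log (⌊2 * S⌋₊ : ℕ)))) :=
          ha2
      _ ≤ (4 * R) * (N * W ^ 2) := by gcongr; linarith
      _ = (2 * Real.sqrt (R * N) * W) ^ 2 := by
          rw [show (2 * Real.sqrt (R * N) * W) ^ 2 = 4 * Real.sqrt (R * N) ^ 2 * W ^ 2 by ring, hRN]
          ring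
  have hsqrt_a : Real.sqrt (∑ r ∈ dyadic R, ∑ s ∈ dyadic S, ∑ n ∈ Finset.Icc 1 N', a n s ^ 2) ≤
      2 * Real.sqrt (R * N) * W := by
    rw [← Real.sqrt_sq (by positivity : 0 ≤ 2 * Real.sqrt (R * N) * W)]
    exact Real.sqrt_le_sqrt ha2'
  -- Step 6: the parameter powers inside `W` are `≤ 8^η P^η`
  set P : ℝ := C * D * N * R * S with hP
  have hP0 : 0 < P := by positivity
  have hCD : 1 ≤ C * D := one_le_mul_of_one_le_of_one_le hC hD
  have hRS : 1 / 4 ≤ R * S := by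
    have := mul_le_mul hR hS (by norm_num) hR0
    linarith
  have hNP : N ≤ 8 * P := by
    have h1 : 1 * (1 / 4) ≤ C * D * (R * S) := mul_le_mul hCD hRS (by norm_num) (by positivity)
    have h2 : N * (1 * (1 / 4)) ≤ N * (C * D * (R * S)) := mul_le_mul_of_nonneg_left h1 (by linarith)
    have h3 : P = N * (C * D * (R * S)) := by rw [hP]; ring
    have h4 : 0 ≤ N * (C * D * (R * S)) := by positivity
    rw [h3]; linarith
  have hCP : 2 * C ≤ 8 * P := by
    have h1 : 1 * (1 / 4) ≤ D * N * (R * S) :=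
      mul_le_mul (one_le_mul_of_one_le_of_one_le hD hN) hRS (by norm_num) (by positivity)
    have h2 : C * (1 * (1 / 4)) ≤ C * (D * N * (R * S)) := mul_le_mul_of_nonneg_left h1 (by linarith)
    have h3 : P = C * (D * N * (R * S)) := by rw [hP]; ring
    have h4 : 0 ≤ C * (D * N * (R * S)) := by positivity
    rw [h3]; linarith
  have hSP : 2 * S ≤ 8 * P := by
    have h1 : 1 * (1 / 2) ≤ C * D * N * R :=
      mul_le_mul (one_le_mul_of_one_le_of_one_le hCD hN) hR (by norm_num) (by positivity)
    have h2 : S * (1 * (1 / 2)) ≤ S * (C * D * N * R) := mul_le_mul_of_nonneg_left h1 hS0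
    have h3 : P = S * (C * D * N * R) := by rw [hP]; ring
    have h4 : 0 ≤ S * (C * D * N * R) := by positivity
    rw [h3]; linarith
  have h8P1 : 1 ≤ 8 * P := by linarith
  have hpow : (N ^ δ) ^ 3 * (2 * C) ^ δ * (2 * S) ^ δ ≤ 8 ^ η * P ^ η := by
    have e3 : (N ^ δ) ^ 3 = N ^ (3 * δ) := by
      rw [← Real.rpow_natCast, ← Real.rpow_mul (by linarith)]; congr 1; push_cast; ring
    rw [e3]
    have h1 : N ^ (3 * δ) ≤ (8 * P) ^ (3 * δ) := Real.rpow_le_rpow (by linarith) hNP (by positivity)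
    have h2 : (2 * C) ^ δ ≤ (8 * P) ^ δ := Real.rpow_le_rpow (by linarith) hCP hδ0.le
    have h3 : (2 * S) ^ δ ≤ (8 * P) ^ δ := Real.rpow_le_rpow (by linarith) hSP hδ0.le
    have h4 : (8 * P) ^ (3 * δ) * (8 * P) ^ δ * (8 * P) ^ δ = (8 * P) ^ η := by
      rw [← Real.rpow_add (by linarith), ← Real.rpow_add (by linarith)]
      congr 1; rw [hδ]; ring
    have h6 : (8 * P) ^ η = 8 ^ η * P ^ η := Real.mul_rpow (by norm_num) hP0.le
    calc N ^ (3 * δ) * (2 * C) ^ δ * (2 * S) ^ δ ≤ (8 * P) ^ (3 * δ) * (8 * P) ^ δ * (8 * P) ^ δ := by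
          gcongr
      _ = 8 ^ η * P ^ η := by rw [h4, h6]
  have hWle : W ≤ Cδ ^ 3 * (1 + 1 / δ) ^ 2 * (8 ^ η * P ^ η) := by
    have e : W = Cδ ^ 3 * (1 + 1 / δ) ^ 2 * ((N ^ δ) ^ 3 * (2 * C) ^ δ * (2 * S) ^ δ) := by
      rw [hW]; ring
    rw [e]
    exact mul_le_mul_of_nonneg_left hpow (by positivity)
  -- Step 7: assemble
  have hnorm0 : 0 ≤ lemma1Norm N' R S B := Real.sqrt_nonneg _
  have hRN' : Real.sqrt (R * N) = Real.sqrt (N * R) := by rw [mul_comm]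
  calc ‖Kzero C D N' R S B‖
      ≤ D * ∑ r ∈ dyadic R, ∑ s ∈ dyadic S, ∑ n ∈ Finset.Icc 1 N', ‖B n r s‖ * a n s := h1
    _ ≤ D * (lemma1Norm N' R S B * (2 * Real.sqrt (R * N) * W)) := by
        refine mul_le_mul_of_nonneg_left (hCS.trans ?_) hD0.le
        rw [hnormB]
        exact mul_le_mul_of_nonneg_left hsqrt_a hnorm0
    _ ≤ D * (lemma1Norm N' R S B * (2 * Real.sqrt (R * N) * (Cδ ^ 3 * (1 + 1 / δ) ^ 2 * (8 ^ η * P ^ η)))) := by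
        gcongr
    _ = 2 * Cδ ^ 3 * (1 + 1 / δ) ^ 2 * 8 ^ η * P ^ η * (D * Real.sqrt (N * R)) * lemma1Norm N' R S B := by
        rw [hRN']; ring


/-! ### The Poisson tails are negligible for `H₀ = ⌈2 (CDNRS)^ε SC/D⌉` -/

/-- `√y ≤ 1 + y` for `y ≥ 0`. [folklore] -/
theorem sqrt_le_one_add {y : ℝ} (hy : 0 ≤ y) : Real.sqrt y ≤ 1 + y := by
  rw [show (1 : ℝ) + y = Real.sqrt ((1 + y) ^ 2) by rw [Real.sqrt_sq (by positivity)]]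
  exact Real.sqrt_le_sqrt (by nlinarith)

/-- **One Poisson tail**: for `s ≤ 2S`, `1 ≤ c ≤ 5C/4`, `D > 0`, `j ≥ 1` and a truncation `H₀` with
`H₀ ≥ L = 2q SC/D` (`q > 0`):  `tailBound(D/4, j, sc, H₀) ≤ 8 K_j S C (q⁻¹)^{j−1}`
(`2sc/(πD) ≤ 2SC/D` as `sc ≤ (5/2)SC ≤ π SC`). [folklore] -/
theorem tailBound_le {C D S q : ℝ} (hC : 1 ≤ C) (hD : 0 < D) (hS : 0 < S) (hq : 0 < q)
    {s c : ℕ} (hs1 : 1 ≤ s) (hs : (s : ℝ) ≤ 2 * S) (hc1 : 1 ≤ c) (hc : (c : ℝ) ≤ 5 / 4 * C)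
    {j : ℕ} (hj : 1 ≤ j) {H₀ : ℕ} (hH : 2 * q * S * C / D ≤ (H₀ : ℝ)) :
    tailBound (D / 4) j (s * c) H₀ ≤ 8 * derivConst j * S * C * (q⁻¹) ^ (j - 1) := by
  unfold tailBound
  have hKj : 1 ≤ derivConst j := one_le_derivConst j
  have hπ : (3 : ℝ) < π := Real.pi_gt_three
  set L : ℝ := 2 * q * S * C / D with hL
  have hL0 : 0 < L := by rw [hL]; positivity
  set b : ℝ := 2 * S * C / D with hb
  have hb0 : 0 < b := by rw [hb]; positivity
  -- the base
  have hsc : ((s * c : ℕ) : ℝ) ≤ 5 / 2 * S * C := by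
    push_cast
    calc (s : ℝ) * c ≤ (2 * S) * (5 / 4 * C) :=
          mul_le_mul hs hc (by positivity) (by positivity)
      _ = 5 / 2 * S * C := by ring
  have hnum : ((s * c : ℕ) : ℝ) * (2 / π) ≤ 2 * S * C := by
    calc ((s * c : ℕ) : ℝ) * (2 / π) ≤ (5 / 2 * S * C) * (2 / π) :=
          mul_le_mul_of_nonneg_right hsc (by positivity)
      _ = S * C * (5 / π) := by ring
      _ ≤ S * C * 2 := by
          refine mul_le_mul_of_nonneg_left ?_ (by positivity)
          rw [div_le_iff₀ (by positivity)]; linarith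
      _ = 2 * S * C := by ring
  have hbase : (D / 4)⁻¹ * (((s * c : ℕ) : ℝ) / (2 * π)) ≤ b := by
    calc (D / 4)⁻¹ * (((s * c : ℕ) : ℝ) / (2 * π)) = ((s * c : ℕ) : ℝ) * (2 / π) / D := by ring
      _ ≤ 2 * S * C / D := div_le_div_of_nonneg_right hnum hD.le
      _ = b := hb.symm
  have hbase0 : 0 ≤ (D / 4)⁻¹ * (((s * c : ℕ) : ℝ) / (2 * π)) := by positivity
  -- `(D/4)⁻¹^j (sc/2π)^j ≤ b^j`
  have hpowj : (D / 4)⁻¹ ^ j * (((s * c : ℕ) : ℝ) / (2 * π)) ^ j ≤ b ^ j := by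
    rw [← mul_pow]; exact pow_le_pow_left₀ hbase0 hbase j
  -- `((H₀+1)^{j-1})⁻¹ ≤ (L^{j-1})⁻¹`
  have hHL : L ≤ (H₀ : ℝ) + 1 := by linarith
  have hinv : (((H₀ : ℝ) + 1) ^ (j - 1))⁻¹ ≤ (L ^ (j - 1))⁻¹ := by
    refine inv_anti₀ (by positivity) ?_
    exact pow_le_pow_left₀ hL0.le hHL _
  -- assemble
  have hbj : b ^ (j - 1) * b = b ^ j := by rw [← pow_succ, Nat.sub_add_cancel hj]
  calc 16 * derivConst j * (D / 4)⁻¹ ^ j * (D / 4) * (((s * c : ℕ) : ℝ) / (2 * π)) ^ j *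
        (((H₀ : ℝ) + 1) ^ (j - 1))⁻¹
      = 4 * derivConst j * D * ((D / 4)⁻¹ ^ j * (((s * c : ℕ) : ℝ) / (2 * π)) ^ j) *
          (((H₀ : ℝ) + 1) ^ (j - 1))⁻¹ := by ring
    _ ≤ 4 * derivConst j * D * b ^ j * (L ^ (j - 1))⁻¹ := by
        gcongr
    _ = 4 * derivConst j * D * b * (b ^ (j - 1) * (L ^ (j - 1))⁻¹) := by
        rw [← hbj]; ring
    _ = 4 * derivConst j * D * b * (q⁻¹) ^ (j - 1) := by
        congr 1
        rw [← inv_pow, ← mul_pow]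
        congr 1
        rw [hb, hL]
        field_simp
    _ = 8 * derivConst j * S * C * (q⁻¹) ^ (j - 1) := by
        rw [hb]; field_simp; norm_num

/-- **The sum of all the Poisson tails is `O_ε(‖B‖)`** for `H₀ = ⌈2(CDNRS)^ε SC/D⌉` and the decay order
`j = ⌈6/ε⌉ + 2`: for every `ε > 0` there is `K_t` such that for `C, D, N ≥ 1`, `R, S ≥ 1/2`,
`∑_{r,s,n} |B_{nrs}| ∑_{c ≤ 5C/4} tailBound(D/4, j, sc, H₀) ≤ K_t ‖B‖`. [folklore] -/
theorem tail_total_le {ε : ℝ} (hε : 0 < ε) :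
    ∃ Kt : ℝ, ∀ C D N R S : ℝ, 1 ≤ C → 1 ≤ D → 1 ≤ N → 1 / 2 ≤ R → 1 / 2 ≤ S →
      ∀ B : ℕ → ℕ → ℕ → ℂ,
        ∑ r ∈ dyadic R, ∑ s ∈ dyadic S, ∑ n ∈ Finset.Icc 1 ⌊N⌋₊, ‖B n r s‖ *
          ∑ c ∈ Finset.Icc 1 ⌊5 / 4 * C⌋₊,
            tailBound (D / 4) (⌈6 / ε⌉₊ + 2) (s * c) ⌈2 * (C * D * N * R * S) ^ ε * S * C / D⌉₊ ≤
          Kt * lemma1Norm ⌊N⌋₊ R S B := by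
  set j : ℕ := ⌈6 / ε⌉₊ + 2 with hj
  refine ⟨40 * derivConst j * (8256 * 4 ^ (6 + 2 * ε)), ?_⟩
  intro C D N R S hC hD hN hR hS B
  have hD0 : 0 < D := by linarith
  have hS0 : 0 < S := by linarith
  have hR0 : 0 < R := by linarith
  have hKj : 1 ≤ derivConst j := one_le_derivConst j
  set P : ℝ := C * D * N * R * S with hP
  have hP0 : 0 < P := by positivity
  set q : ℝ := P ^ ε with hq
  have hq0 : 0 < q := Real.rpow_pos_of_pos hP0 ε
  set H₀ : ℕ := ⌈2 * q * S * C / D⌉₊ with hH₀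
  have hH : 2 * q * S * C / D ≤ (H₀ : ℝ) := Nat.le_ceil _
  set N' : ℕ := ⌊N⌋₊ with hN'
  have hN'le : (N' : ℝ) ≤ N := Nat.floor_le (by linarith)
  -- the uniform bound for the inner `c`-sum
  set U : ℝ := 10 * derivConst j * S * C ^ 2 * (q⁻¹) ^ (j - 1) with hU
  have hU0 : 0 ≤ U := by positivity
  have hcsum : ∀ s ∈ dyadic S, ∑ c ∈ Finset.Icc 1 ⌊5 / 4 * C⌋₊, tailBound (D / 4) j (s * c) H₀ ≤ U := by
    intro s hs
    have hsm := (mem_dyadic hS0.le).1 hs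
    have hs1 : 1 ≤ s := pos_of_mem_dyadic hS0.le hs
    have hterm : ∀ c ∈ Finset.Icc 1 ⌊5 / 4 * C⌋₊, tailBound (D / 4) j (s * c) H₀ ≤
        8 * derivConst j * S * C * (q⁻¹) ^ (j - 1) := by
      intro c hc
      rw [Finset.mem_Icc] at hc
      have hcle : (c : ℝ) ≤ 5 / 4 * C := le_trans (by exact_mod_cast hc.2) (Nat.floor_le (by linarith))
      exact tailBound_le hC hD0 hS0 hq0 hs1 hsm.2 hc.1 hcle (by omega) hH
    refine (Finset.sum_le_sum hterm).trans ?_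
    rw [Finset.sum_const, Nat.card_Icc, Nat.add_sub_cancel, nsmul_eq_mul]
    have hX : ((⌊5 / 4 * C⌋₊ : ℕ) : ℝ) ≤ 5 / 4 * C := Nat.floor_le (by linarith)
    calc ((⌊5 / 4 * C⌋₊ : ℕ) : ℝ) * (8 * derivConst j * S * C * (q⁻¹) ^ (j - 1))
        ≤ (5 / 4 * C) * (8 * derivConst j * S * C * (q⁻¹) ^ (j - 1)) :=
          mul_le_mul_of_nonneg_right hX (by positivity)
      _ = U := by rw [hU]; ring
  -- `∑ |B| ≤ (16 RSN)^{1/2} ‖B‖`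
  have hCS := sum3_mul_le_sqrt_mul_sqrt (dyadic R) (dyadic S) (Finset.Icc 1 N')
    (fun r s n => ‖B n r s‖) (fun _ _ _ => (1 : ℝ))
  have hcount : ∑ r ∈ dyadic R, ∑ s ∈ dyadic S, ∑ n ∈ Finset.Icc 1 N', (1 : ℝ) ^ 2 ≤ 16 * (R * S * N) := by
    simp only [one_pow, Finset.sum_const, nsmul_eq_mul, mul_one, Nat.card_Icc, Nat.add_sub_cancel]
    have h1 := card_dyadic_le hR0.le
    have h2 := card_dyadic_le hS0.le
    calc (#(dyadic R) : ℝ) * ((#(dyadic S) : ℝ) * (N' : ℝ)) ≤ (4 * R) * ((4 * S) * N) := by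
          apply mul_le_mul (by linarith) (mul_le_mul (by linarith) hN'le (Nat.cast_nonneg _) (by linarith))
            (by positivity) (by linarith)
      _ = 16 * (R * S * N) := by ring
  have hsumB : ∑ r ∈ dyadic R, ∑ s ∈ dyadic S, ∑ n ∈ Finset.Icc 1 N', ‖B n r s‖ ≤
      lemma1Norm N' R S B * (4 * Real.sqrt (R * S * N)) := by
    have e : ∑ r ∈ dyadic R, ∑ s ∈ dyadic S, ∑ n ∈ Finset.Icc 1 N', ‖B n r s‖ =
        ∑ r ∈ dyadic R, ∑ s ∈ dyadic S, ∑ n ∈ Finset.Icc 1 N', ‖B n r s‖ * 1 := by simp only [mul_one]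
    rw [e]
    refine hCS.trans (mul_le_mul_of_nonneg_left ?_ (Real.sqrt_nonneg _))
    calc Real.sqrt (∑ r ∈ dyadic R, ∑ s ∈ dyadic S, ∑ n ∈ Finset.Icc 1 N', (1 : ℝ) ^ 2)
        ≤ Real.sqrt (16 * (R * S * N)) := Real.sqrt_le_sqrt hcount
      _ = 4 * Real.sqrt (R * S * N) := by
          rw [Real.sqrt_mul (by norm_num), show (16 : ℝ) = 4 ^ 2 by norm_num, Real.sqrt_sq (by norm_num)]
  -- the main estimate `U · 4 √(RSN) ≤ Kt`
  have hmain : U * (4 * Real.sqrt (R * S * N)) ≤ 40 * derivConst j * (8256 * 4 ^ (6 + 2 * ε)) := by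
    -- sizes in terms of `P`
    have hCD : 1 ≤ C * D := one_le_mul_of_one_le_of_one_le hC hD
    have hRS : 1 / 4 ≤ R * S := by
      have := mul_le_mul hR hS (by norm_num) hR0.le
      linarith
    have hNP : N ≤ 8 * P := by
      have h1 : 1 * (1 / 4) ≤ C * D * (R * S) := mul_le_mul hCD hRS (by norm_num) (by positivity)
      have h2 : N * (1 * (1 / 4)) ≤ N * (C * D * (R * S)) := mul_le_mul_of_nonneg_left h1 (by linarith)
      have h3 : P = N * (C * D * (R * S)) := by rw [hP]; ring
      have h4 : 0 ≤ N * (C * D * (R * S)) := by positivity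
      rw [h3]; linarith
    have hCP : C ≤ 4 * P := by
      have h1 : 1 * (1 / 4) ≤ D * N * (R * S) :=
        mul_le_mul (one_le_mul_of_one_le_of_one_le hD hN) hRS (by norm_num) (by positivity)
      have h2 : C * (1 * (1 / 4)) ≤ C * (D * N * (R * S)) := mul_le_mul_of_nonneg_left h1 (by linarith)
      have h3 : P = C * (D * N * (R * S)) := by rw [hP]; ring
      rw [h3]; linarith
    have hSP : S ≤ 4 * P := by
      have h1 : 1 * (1 / 2) ≤ C * D * N * R :=
        mul_le_mul (one_le_mul_of_one_le_of_one_le hCD hN) hR (by norm_num) (by positivity)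
      have h2 : S * (1 * (1 / 2)) ≤ S * (C * D * N * R) := mul_le_mul_of_nonneg_left h1 hS0.le
      have h3 : P = S * (C * D * N * R) := by rw [hP]; ring
      have h4 : 0 ≤ S * (C * D * N * R) := by positivity
      rw [h3]; linarith
    have hRP : R ≤ 4 * P := by
      have h1 : 1 * (1 / 2) ≤ C * D * N * S :=
        mul_le_mul (one_le_mul_of_one_le_of_one_le hCD hN) hS (by norm_num) (by positivity)
      have h2 : R * (1 * (1 / 2)) ≤ R * (C * D * N * S) := mul_le_mul_of_nonneg_left h1 hR0.le
      have h3 : P = R * (C * D * N * S) := by rw [hP]; ring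
      have h4 : 0 ≤ R * (C * D * N * S) := by positivity
      rw [h3]; linarith
    -- `S C² √(RSN) ≤ 64 P³ (1 + 128 P³)`
    have hsize : S * C ^ 2 * Real.sqrt (R * S * N) ≤ 64 * P ^ 3 * (1 + 128 * P ^ 3) := by
      have h1 : S * C ^ 2 ≤ 64 * P ^ 3 := by
        calc S * C ^ 2 ≤ (4 * P) * (4 * P) ^ 2 := by gcongr
          _ = 64 * P ^ 3 := by ring
      have h2 : Real.sqrt (R * S * N) ≤ 1 + 128 * P ^ 3 := by
        refine (sqrt_le_one_add (by positivity)).trans ?_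
        have : R * S * N ≤ (4 * P) * (4 * P) * (8 * P) := by
          apply mul_le_mul (mul_le_mul hRP hSP hS0.le (by positivity)) hNP (by linarith) (by positivity)
        linarith
      exact mul_le_mul h1 h2 (Real.sqrt_nonneg _) (by positivity)
    -- the decay factor `(q⁻¹)^{j-1} = (P^{ε(j-1)})⁻¹`
    have hm : (((j - 1 : ℕ) : ℝ)) = (⌈6 / ε⌉₊ : ℝ) + 1 := by
      rw [hj, Nat.add_sub_assoc (by norm_num : 1 ≤ 2)]; push_cast; ring
    have hεε : ε * (6 / ε) = 6 := by field_simp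
    have hεm_ge : 6 ≤ ε * ((j - 1 : ℕ) : ℝ) := by
      rw [hm, mul_add, mul_one]
      have h := mul_le_mul_of_nonneg_left (Nat.le_ceil (6 / ε)) hε.le
      linarith
    have hεm_le : ε * ((j - 1 : ℕ) : ℝ) ≤ 6 + 2 * ε := by
      rw [hm, mul_add, mul_one]
      have h := mul_le_mul_of_nonneg_left (Nat.ceil_lt_add_one (by positivity : 0 ≤ 6 / ε)).le hε.le
      rw [mul_add, mul_one] at h
      linarith
    have hqpow : (q⁻¹) ^ (j - 1) = (P ^ (ε * ((j - 1 : ℕ) : ℝ)))⁻¹ := by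
      rw [inv_pow, hq, ← Real.rpow_natCast, ← Real.rpow_mul hP0.le]
    have hdecay : P ^ 3 * (1 + 128 * P ^ 3) * (P ^ (ε * ((j - 1 : ℕ) : ℝ)))⁻¹ ≤ 129 * 4 ^ (6 + 2 * ε) := by
      have h4pos : (0 : ℝ) < 4 ^ (6 + 2 * ε) := by positivity
      have h41 : (1 : ℝ) ≤ 4 ^ (6 + 2 * ε) := Real.one_le_rpow (by norm_num) (by positivity)
      rcases le_or_gt 1 P with hP1 | hP1
      · -- `P ≥ 1`: `P^{εm} ≥ P^6` and `P³(1 + 128P³) ≤ 129 P⁶`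
        have h1 : P ^ (6 : ℝ) ≤ P ^ (ε * ((j - 1 : ℕ) : ℝ)) := Real.rpow_le_rpow_of_exponent_le hP1 hεm_ge
        have h1' : (P ^ (ε * ((j - 1 : ℕ) : ℝ)))⁻¹ ≤ (P ^ 6)⁻¹ := by
          rw [show (P ^ 6 : ℝ) = P ^ (6 : ℝ) by norm_cast]
          exact inv_anti₀ (by positivity) h1
        have h2 : P ^ 3 * (1 + 128 * P ^ 3) ≤ 129 * P ^ 6 := by
          have : P ^ 3 ≤ P ^ 6 := pow_le_pow_right₀ hP1 (by norm_num)
          have e : P ^ 3 * (1 + 128 * P ^ 3) = P ^ 3 + 128 * P ^ 6 := by ring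
          linarith
        calc P ^ 3 * (1 + 128 * P ^ 3) * (P ^ (ε * ((j - 1 : ℕ) : ℝ)))⁻¹
            ≤ (129 * P ^ 6) * (P ^ 6)⁻¹ := mul_le_mul h2 h1' (by positivity) (by positivity)
          _ = 129 := by field_simp
          _ ≤ 129 * 4 ^ (6 + 2 * ε) := by
              have := mul_le_mul_of_nonneg_left h41 (by norm_num : (0 : ℝ) ≤ 129)
              linarith
      · -- `P < 1`: `P^{εm} ≥ P^{6+2ε} ≥ (1/4)^{6+2ε}` and `P³(1+128P³) ≤ 129`
        have hP41 : 1 / 4 ≤ P := by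
          have h1 : 1 * (1 / 4) ≤ (C * D * N) * (R * S) :=
            mul_le_mul (one_le_mul_of_one_le_of_one_le hCD hN) hRS (by norm_num) (by positivity)
          have h3 : P = (C * D * N) * (R * S) := by rw [hP]; ring
          rw [h3]; linarith
        have h1 : P ^ (6 + 2 * ε) ≤ P ^ (ε * ((j - 1 : ℕ) : ℝ)) :=
          Real.rpow_le_rpow_of_exponent_ge hP0 hP1.le hεm_le
        have h2 : (1 / 4 : ℝ) ^ (6 + 2 * ε) ≤ P ^ (6 + 2 * ε) :=
          Real.rpow_le_rpow (by norm_num) hP41 (by positivity)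
        have h3 : (P ^ (ε * ((j - 1 : ℕ) : ℝ)))⁻¹ ≤ ((1 / 4 : ℝ) ^ (6 + 2 * ε))⁻¹ :=
          inv_anti₀ (by positivity) (h2.trans h1)
        have h4 : ((1 / 4 : ℝ) ^ (6 + 2 * ε))⁻¹ = 4 ^ (6 + 2 * ε) := by
          rw [← Real.inv_rpow (by norm_num), one_div, inv_inv]
        have h5 : P ^ 3 * (1 + 128 * P ^ 3) ≤ 129 := by
          have h3' : P ^ 3 ≤ 1 := pow_le_one₀ hP0.le hP1.le
          have h6' : P ^ 6 ≤ 1 := pow_le_one₀ hP0.le hP1.le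
          have e : P ^ 3 * (1 + 128 * P ^ 3) = P ^ 3 + 128 * P ^ 6 := by ring
          linarith
        calc P ^ 3 * (1 + 128 * P ^ 3) * (P ^ (ε * ((j - 1 : ℕ) : ℝ)))⁻¹
            ≤ 129 * ((1 / 4 : ℝ) ^ (6 + 2 * ε))⁻¹ := mul_le_mul h5 h3 (by positivity) (by positivity)
          _ = 129 * 4 ^ (6 + 2 * ε) := by rw [h4]
    calc U * (4 * Real.sqrt (R * S * N))
        = 40 * derivConst j * (S * C ^ 2 * Real.sqrt (R * S * N)) * (q⁻¹) ^ (j - 1) := by rw [hU]; ring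
      _ ≤ 40 * derivConst j * (64 * P ^ 3 * (1 + 128 * P ^ 3)) * (q⁻¹) ^ (j - 1) := by
          gcongr
      _ = 40 * derivConst j * 64 * (P ^ 3 * (1 + 128 * P ^ 3) * (P ^ (ε * ((j - 1 : ℕ) : ℝ)))⁻¹) := by
          rw [hqpow]; ring
      _ ≤ 40 * derivConst j * 64 * (129 * 4 ^ (6 + 2 * ε)) :=
          mul_le_mul_of_nonneg_left hdecay (by positivity)
      _ = 40 * derivConst j * (8256 * 4 ^ (6 + 2 * ε)) := by ring
  -- assemble
  have hnorm0 : 0 ≤ lemma1Norm N' R S B := Real.sqrt_nonneg _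
  calc ∑ r ∈ dyadic R, ∑ s ∈ dyadic S, ∑ n ∈ Finset.Icc 1 N', ‖B n r s‖ *
          ∑ c ∈ Finset.Icc 1 ⌊5 / 4 * C⌋₊, tailBound (D / 4) j (s * c) H₀
      ≤ ∑ r ∈ dyadic R, ∑ s ∈ dyadic S, ∑ n ∈ Finset.Icc 1 N', ‖B n r s‖ * U := by
        refine Finset.sum_le_sum fun r _ => Finset.sum_le_sum fun s hs => Finset.sum_le_sum fun n _ => ?_
        exact mul_le_mul_of_nonneg_left (hcsum s hs) (norm_nonneg _)
    _ = (∑ r ∈ dyadic R, ∑ s ∈ dyadic S, ∑ n ∈ Finset.Icc 1 N', ‖B n r s‖) * U := by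
        rw [Finset.sum_mul]
        refine Finset.sum_congr rfl fun r _ => ?_
        rw [Finset.sum_mul]
        refine Finset.sum_congr rfl fun s _ => ?_
        rw [Finset.sum_mul]
    _ ≤ (lemma1Norm N' R S B * (4 * Real.sqrt (R * S * N))) * U := mul_le_mul_of_nonneg_right hsumB hU0
    _ = lemma1Norm N' R S B * (U * (4 * Real.sqrt (R * S * N))) := by ring
    _ ≤ lemma1Norm N' R S B * (40 * derivConst j * (8256 * 4 ^ (6 + 2 * ε))) :=
        mul_le_mul_of_nonneg_left hmain hnorm0
    _ = _ := by ring

/-! ### The reduction: the corrected Lemma 1 from the off-diagonal bound -/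

/-- **The corrected Lemma 1 for `w ⊗ w`, reduced to its off-diagonal part.**  Write `P = CDNRS`,
`H₀ = ⌈2 P^ε SC/D⌉`, and `𝓚♯ = BFI.L1.Koff C D ⌊N⌋ R S H₀ B` for the sum of the complete Kloosterman sums
`S(±h, n r̄; sc)` (`1 ≤ h ≤ H₀`) against the Fourier coefficients of `w(·/D)` that the Poisson
summation in `d` produces.  IF for every `ε > 0` there is `K` with
`‖𝓚♯‖ ≤ K P^ε {CS(RS + N)(C + DR) + C²DS√((RS + N)R)}^{1/2} ‖B‖` for all `C, D, N ≥ 1`, `R, S ≥ 1/2`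
and all `B` — this is what Deshouillers–Iwaniec obtain from Kuznetsov's formula and their large sieve
inequalities (Invent. Math. 70 (1982), §9.2, proof of Theorem 12 after (9.11)) — THEN for every
`ε > 0` there is `K'` with
`‖𝓚(C, D, N, R, S)‖ ≤ K' P^ε {CS(RS + N)(C + DR) + C²DS√((RS + N)R) + D²NR}^{1/2} ‖B‖`,
i.e. the corrected Lemma 1 (BFI 2019, Lemma 2.1) for the weight `w ⊗ w`.  PROVED here: the completion
(`BFI.L1.norm_dispK_sub_Kzero_sub_Koff_le`), the zero frequency `≪ P^ε D(NR)^{1/2}‖B‖` (the corrected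
(9.11), `BFI.L1.norm_Kzero_le`) and the tails (`BFI.L1.tail_total_le`).
[cite: BombieriFriedlanderIwaniec2019, §2 Lemma 2.1 and the remark on (9.11) of Deshouillers–Iwaniec] -/
theorem norm_dispK_le_of_offdiag
    (hoff : ∀ ε : ℝ, 0 < ε → ∃ K : ℝ, ∀ C D N R S : ℝ, 1 ≤ C → 1 ≤ D → 1 ≤ N → 1 / 2 ≤ R →
      1 / 2 ≤ S → ∀ B : ℕ → ℕ → ℕ → ℂ,
        ‖Koff C D ⌊N⌋₊ R S ⌈2 * (C * D * N * R * S) ^ ε * S * C / D⌉₊ B‖ ≤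
          K * (C * D * N * R * S) ^ ε *
            Real.sqrt (C * S * (R * S + N) * (C + D * R) + C ^ 2 * D * S * Real.sqrt ((R * S + N) * R)) *
            lemma1Norm ⌊N⌋₊ R S B)
    {ε : ℝ} (hε : 0 < ε) :
    ∃ K' : ℝ, ∀ C D N R S : ℝ, 1 ≤ C → 1 ≤ D → 1 ≤ N → 1 / 2 ≤ R → 1 / 2 ≤ S →
      ∀ B : ℕ → ℕ → ℕ → ℂ,
        ‖dispK (fun c d => plateau2 (c / C) (d / D)) ⌊5 / 4 * C⌋₊ ⌊5 / 4 * D⌋₊ ⌊N⌋₊ R S B‖ ≤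
          K' * (C * D * N * R * S) ^ ε *
            Real.sqrt (C * S * (R * S + N) * (C + D * R) + C ^ 2 * D * S * Real.sqrt ((R * S + N) * R) +
              D ^ 2 * N * R) * lemma1Norm ⌊N⌋₊ R S B := by
  obtain ⟨K, hK⟩ := hoff ε hε
  obtain ⟨K₀, hK₀⟩ := norm_Kzero_le hε
  obtain ⟨Kt, hKt⟩ := tail_total_le hε
  refine ⟨max K 0 + max K₀ 0 + 2 * 4 ^ ε * max Kt 0, ?_⟩
  intro C D N R S hC hD hN hR hS B
  have hD0 : 0 < D := by linarith
  have hS0 : 0 ≤ S := by linarith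
  have hR0 : 0 ≤ R := by linarith
  set P : ℝ := C * D * N * R * S with hP
  have hP0 : 0 < P := by positivity
  set H₀ : ℕ := ⌈2 * P ^ ε * S * C / D⌉₊ with hH₀
  set j : ℕ := ⌈6 / ε⌉₊ + 2 with hj
  have hj2 : 2 ≤ j := by omega
  set N' : ℕ := ⌊N⌋₊ with hN'
  set T₁ : ℝ := C * S * (R * S + N) * (C + D * R) with hT₁
  set T₂ : ℝ := C ^ 2 * D * S * Real.sqrt ((R * S + N) * R) with hT₂
  set Ic : ℝ := Real.sqrt (T₁ + T₂ + D ^ 2 * N * R) with hIc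
  have hT₁0 : 0 ≤ T₁ := by positivity
  have hT₂0 : 0 ≤ T₂ := by positivity
  have hnB : 0 ≤ lemma1Norm N' R S B := Real.sqrt_nonneg _
  have hPε : 0 ≤ P ^ ε := Real.rpow_nonneg hP0.le _
  -- the three pieces
  have h0 := hK₀ C D N R S hC hD hN hR hS B
  have h1 := hK C D N R S hC hD hN hR hS B
  have h2 := (norm_dispK_sub_Kzero_sub_Koff_le (C := C) hD0 N' R hS0 H₀ hj2 B).trans
    (hKt C D N R S hC hD hN hR hS B)
  -- comparison of the three currencies with `Ic`
  have hI1 : D * Real.sqrt (N * R) ≤ Ic := by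
    rw [hIc, show D * Real.sqrt (N * R) = Real.sqrt (D ^ 2 * N * R) by
      rw [show D ^ 2 * N * R = D ^ 2 * (N * R) by ring, Real.sqrt_mul (sq_nonneg _), Real.sqrt_sq hD0.le]]
    exact Real.sqrt_le_sqrt (by linarith)
  have hDNR : 0 ≤ D ^ 2 * N * R := by positivity
  have hI2 : Real.sqrt (T₁ + T₂) ≤ Ic := Real.sqrt_le_sqrt (by linarith)
  have hI3 : 1 ≤ 2 * 4 ^ ε * (P ^ ε * Ic) := by
    -- `T₁ ≥ 1/2` so `Ic ≥ 1/√2 ≥ 1/2`, and `4^ε P^ε = (4P)^ε ≥ 1`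
    have hT₁half : 1 / 2 ≤ T₁ := by
      rw [hT₁]
      have h1 : 1 / 2 ≤ C * S := by nlinarith
      have h2 : 1 ≤ R * S + N := by nlinarith
      have h3 : 1 ≤ C + D * R := by nlinarith
      calc (1 / 2 : ℝ) = 1 / 2 * 1 * 1 := by ring
        _ ≤ C * S * (R * S + N) * (C + D * R) := by
            apply mul_le_mul (mul_le_mul h1 h2 (by norm_num) (by positivity)) h3 (by norm_num) (by positivity)
    have hIc_ge : 1 / 2 ≤ Ic := by
      rw [hIc]
      refine Real.le_sqrt_of_sq_le ?_
      have h14 : (1 / 2 : ℝ) ^ 2 = 1 / 4 := by norm_num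
      linarith
    have h4P : 1 ≤ 4 ^ ε * P ^ ε := by
      rw [← Real.mul_rpow (by norm_num) hP0.le]
      refine Real.one_le_rpow ?_ hε.le
      have hCD : 1 ≤ C * D := one_le_mul_of_one_le_of_one_le hC hD
      have hRS : 1 / 4 ≤ R * S := by
        have := mul_le_mul hR hS (by norm_num) hR0
        linarith
      have h1 : 1 * (1 / 4) ≤ (C * D * N) * (R * S) :=
        mul_le_mul (one_le_mul_of_one_le_of_one_le hCD hN) hRS (by norm_num) (by positivity)
      have h3 : P = (C * D * N) * (R * S) := by rw [hP]; ring
      rw [h3]; linarith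
    calc (1 : ℝ) = 2 * 1 * (1 / 2) := by ring
      _ ≤ 2 * (4 ^ ε * P ^ ε) * Ic := by
          apply mul_le_mul (mul_le_mul_of_nonneg_left h4P (by norm_num)) hIc_ge (by norm_num) (by positivity)
      _ = 2 * 4 ^ ε * (P ^ ε * Ic) := by ring
  -- triangle inequality
  have htri : ‖dispK (fun c d => plateau2 (c / C) (d / D)) ⌊5 / 4 * C⌋₊ ⌊5 / 4 * D⌋₊ N' R S B‖ ≤
      ‖Kzero C D N' R S B‖ + ‖Koff C D N' R S H₀ B‖ +
        ‖dispK (fun c d => plateau2 (c / C) (d / D)) ⌊5 / 4 * C⌋₊ ⌊5 / 4 * D⌋₊ N' R S B -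
          Kzero C D N' R S B - Koff C D N' R S H₀ B‖ := by
    set x := dispK (fun c d => plateau2 (c / C) (d / D)) ⌊5 / 4 * C⌋₊ ⌊5 / 4 * D⌋₊ N' R S B
    set y := Kzero C D N' R S B
    set z := Koff C D N' R S H₀ B
    calc ‖x‖ = ‖y + z + (x - y - z)‖ := by congr 1; ring
      _ ≤ ‖y + z‖ + ‖x - y - z‖ := norm_add_le _ _
      _ ≤ ‖y‖ + ‖z‖ + ‖x - y - z‖ := by linarith [norm_add_le y z]
  -- each piece against `P^ε Ic ‖B‖`
  have hA : ‖Kzero C D N' R S B‖ ≤ max K₀ 0 * (P ^ ε * Ic * lemma1Norm N' R S B) := by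
    refine h0.trans ?_
    calc K₀ * P ^ ε * (D * Real.sqrt (N * R)) * lemma1Norm N' R S B
        = K₀ * (P ^ ε * (D * Real.sqrt (N * R)) * lemma1Norm N' R S B) := by ring
      _ ≤ max K₀ 0 * (P ^ ε * (D * Real.sqrt (N * R)) * lemma1Norm N' R S B) :=
          mul_le_mul_of_nonneg_right (le_max_left _ _) (by positivity)
      _ ≤ max K₀ 0 * (P ^ ε * Ic * lemma1Norm N' R S B) := by
          refine mul_le_mul_of_nonneg_left ?_ (le_max_right _ _)
          exact mul_le_mul_of_nonneg_right (mul_le_mul_of_nonneg_left hI1 hPε) hnB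
  have hBoff : ‖Koff C D N' R S H₀ B‖ ≤ max K 0 * (P ^ ε * Ic * lemma1Norm N' R S B) := by
    refine h1.trans ?_
    calc K * P ^ ε * Real.sqrt (T₁ + T₂) * lemma1Norm N' R S B
        = K * (P ^ ε * Real.sqrt (T₁ + T₂) * lemma1Norm N' R S B) := by ring
      _ ≤ max K 0 * (P ^ ε * Real.sqrt (T₁ + T₂) * lemma1Norm N' R S B) :=
          mul_le_mul_of_nonneg_right (le_max_left _ _) (by positivity)
      _ ≤ max K 0 * (P ^ ε * Ic * lemma1Norm N' R S B) := by
          refine mul_le_mul_of_nonneg_left ?_ (le_max_right _ _)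
          exact mul_le_mul_of_nonneg_right (mul_le_mul_of_nonneg_left hI2 hPε) hnB
  have hCtail : ‖dispK (fun c d => plateau2 (c / C) (d / D)) ⌊5 / 4 * C⌋₊ ⌊5 / 4 * D⌋₊ N' R S B -
      Kzero C D N' R S B - Koff C D N' R S H₀ B‖ ≤
      2 * 4 ^ ε * max Kt 0 * (P ^ ε * Ic * lemma1Norm N' R S B) := by
    refine h2.trans ?_
    calc Kt * lemma1Norm N' R S B ≤ max Kt 0 * lemma1Norm N' R S B :=
          mul_le_mul_of_nonneg_right (le_max_left _ _) hnB
      _ = max Kt 0 * lemma1Norm N' R S B * 1 := (mul_one _).symm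
      _ ≤ max Kt 0 * lemma1Norm N' R S B * (2 * 4 ^ ε * (P ^ ε * Ic)) :=
          mul_le_mul_of_nonneg_left hI3 (by positivity)
      _ = 2 * 4 ^ ε * max Kt 0 * (P ^ ε * Ic * lemma1Norm N' R S B) := by ring
  calc ‖dispK (fun c d => plateau2 (c / C) (d / D)) ⌊5 / 4 * C⌋₊ ⌊5 / 4 * D⌋₊ N' R S B‖
      ≤ max K₀ 0 * (P ^ ε * Ic * lemma1Norm N' R S B) + max K 0 * (P ^ ε * Ic * lemma1Norm N' R S B) +
          2 * 4 ^ ε * max Kt 0 * (P ^ ε * Ic * lemma1Norm N' R S B) := by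
        linarith [htri, hA, hBoff, hCtail]
    _ = (max K 0 + max K₀ 0 + 2 * 4 ^ ε * max Kt 0) * P ^ ε * Ic * lemma1Norm N' R S B := by ring

end L1

/-- **The corrected Lemma 1 for `w ⊗ w` from its off-diagonal part** (`BFI.Lemma1BoundCorrected
BFI.plateau2 (5/4)` of `…Lemma1Corrected` from the bound for `BFI.L1.Koff`): the completion, the zero
frequency and the tails are proved in this file. [cite: BombieriFriedlanderIwaniec2019, §2 Lemma 2.1] -/
theorem lemma1BoundCorrected_plateau2_of_offdiag
    (hoff : ∀ ε : ℝ, 0 < ε → ∃ K : ℝ, ∀ C D N R S : ℝ, 1 ≤ C → 1 ≤ D → 1 ≤ N → 1 / 2 ≤ R →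
      1 / 2 ≤ S → ∀ B : ℕ → ℕ → ℕ → ℂ,
        ‖L1.Koff C D ⌊N⌋₊ R S ⌈2 * (C * D * N * R * S) ^ ε * S * C / D⌉₊ B‖ ≤
          K * (C * D * N * R * S) ^ ε *
            Real.sqrt (C * S * (R * S + N) * (C + D * R) + C ^ 2 * D * S * Real.sqrt ((R * S + N) * R)) *
            lemma1Norm ⌊N⌋₊ R S B) :
    Lemma1BoundCorrected plateau2 (5 / 4) := by
  intro ε hε
  obtain ⟨K', h⟩ := L1.norm_dispK_le_of_offdiag hoff hε
  exact ⟨K', h⟩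

end BFI

open BFI

/-- **BFI 1986, Theorem 1 (§8, p. 225) from the off-diagonal bound for the complete Kloosterman sums
of Lemma 1** (through `BombieriFriedlanderIwaniecTheorem1_of_lemma1corr`).
[cite: BombieriFriedlanderIwaniec2019, §2 Lemma 2.1; BombieriFriedlanderIwaniecActa1986, §8 Theorem 1 p. 225] -/
theorem BombieriFriedlanderIwaniecTheorem1_of_offdiag
    (hoff : ∀ ε : ℝ, 0 < ε → ∃ K : ℝ, ∀ C D N R S : ℝ, 1 ≤ C → 1 ≤ D → 1 ≤ N → 1 / 2 ≤ R →
      1 / 2 ≤ S → ∀ B : ℕ → ℕ → ℕ → ℂ,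
        ‖BFI.L1.Koff C D ⌊N⌋₊ R S ⌈2 * (C * D * N * R * S) ^ ε * S * C / D⌉₊ B‖ ≤
          K * (C * D * N * R * S) ^ ε *
            Real.sqrt (C * S * (R * S + N) * (C + D * R) + C ^ 2 * D * S * Real.sqrt ((R * S + N) * R)) *
            BFI.lemma1Norm ⌊N⌋₊ R S B) :
    BombieriFriedlanderIwaniecTheorem1 :=
  BombieriFriedlanderIwaniecTheorem1_of_lemma1corr (lemma1BoundCorrected_plateau2_of_offdiag hoff)

/-- **BFI 1986, Theorem 5 (§12, p. 237) from the off-diagonal bound** (through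
`BombieriFriedlanderIwaniecTheorem5_of_lemma1corr`).
[cite: BombieriFriedlanderIwaniec2019, §2 Lemma 2.1; BombieriFriedlanderIwaniecActa1986, §12 Theorem 5 p. 237] -/
theorem BombieriFriedlanderIwaniecTheorem5_of_offdiag
    (hoff : ∀ ε : ℝ, 0 < ε → ∃ K : ℝ, ∀ C D N R S : ℝ, 1 ≤ C → 1 ≤ D → 1 ≤ N → 1 / 2 ≤ R →
      1 / 2 ≤ S → ∀ B : ℕ → ℕ → ℕ → ℂ,
        ‖BFI.L1.Koff C D ⌊N⌋₊ R S ⌈2 * (C * D * N * R * S) ^ ε * S * C / D⌉₊ B‖ ≤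
          K * (C * D * N * R * S) ^ ε *
            Real.sqrt (C * S * (R * S + N) * (C + D * R) + C ^ 2 * D * S * Real.sqrt ((R * S + N) * R)) *
            BFI.lemma1Norm ⌊N⌋₊ R S B) :
    BombieriFriedlanderIwaniecTheorem5 :=
  BombieriFriedlanderIwaniecTheorem5_of_lemma1corr (lemma1BoundCorrected_plateau2_of_offdiag hoff)

/-- **BFI 1986, Theorem 5* (§12, p. 238) from the off-diagonal bound.**
[cite: BombieriFriedlanderIwaniec2019, §2 Lemma 2.1; BombieriFriedlanderIwaniecActa1986, §12 Theorem 5* p. 238] -/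
theorem BombieriFriedlanderIwaniecTheorem5Star_of_offdiag
    (hoff : ∀ ε : ℝ, 0 < ε → ∃ K : ℝ, ∀ C D N R S : ℝ, 1 ≤ C → 1 ≤ D → 1 ≤ N → 1 / 2 ≤ R →
      1 / 2 ≤ S → ∀ B : ℕ → ℕ → ℕ → ℂ,
        ‖BFI.L1.Koff C D ⌊N⌋₊ R S ⌈2 * (C * D * N * R * S) ^ ε * S * C / D⌉₊ B‖ ≤
          K * (C * D * N * R * S) ^ ε *
            Real.sqrt (C * S * (R * S + N) * (C + D * R) + C ^ 2 * D * S * Real.sqrt ((R * S + N) * R)) *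
            BFI.lemma1Norm ⌊N⌋₊ R S B) :
    BombieriFriedlanderIwaniecTheorem5Star :=
  BombieriFriedlanderIwaniecTheorem5Star_of_lemma1corr (lemma1BoundCorrected_plateau2_of_offdiag hoff)

/-- **BFI 1986, Theorem 5* on boxes (§12, §15) from the off-diagonal bound.**
[cite: BombieriFriedlanderIwaniec2019, §2 Lemma 2.1; BombieriFriedlanderIwaniecActa1986, §12 Theorem 5* p. 238, §15 p. 246] -/
theorem BombieriFriedlanderIwaniecTheorem5StarInterval_of_offdiag
    (hoff : ∀ ε : ℝ, 0 < ε → ∃ K : ℝ, ∀ C D N R S : ℝ, 1 ≤ C → 1 ≤ D → 1 ≤ N → 1 / 2 ≤ R →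
      1 / 2 ≤ S → ∀ B : ℕ → ℕ → ℕ → ℂ,
        ‖BFI.L1.Koff C D ⌊N⌋₊ R S ⌈2 * (C * D * N * R * S) ^ ε * S * C / D⌉₊ B‖ ≤
          K * (C * D * N * R * S) ^ ε *
            Real.sqrt (C * S * (R * S + N) * (C + D * R) + C ^ 2 * D * S * Real.sqrt ((R * S + N) * R)) *
            BFI.lemma1Norm ⌊N⌋₊ R S B) :
    BombieriFriedlanderIwaniecTheorem5StarInterval :=
  BombieriFriedlanderIwaniecTheorem5StarInterval_of_lemma1corr
    (lemma1BoundCorrected_plateau2_of_offdiag hoff)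

end Literature.NumberTheory.Sieve
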